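/-
Copyright: b2b-lace packet (literature seat, gen 14).  [FvdH17] §4.2: the repulsive SQUARE "defined in the same
manner" as (4.17), with its four lines on up to four INDEPENDENT configurations, and the extraction bound
[NoBLE17-I] (5.42) for EVERY configuration assignment — proved on the product space `ℙ_p^{⊗k}` by the method of
`RepulsiveTriangleExtractionIndep` (coding → cut at `M` → boxes of labelled pieces → `Measure.pi_pi` × BK).
No named fact; no numeral; no dimension.
-/
import Literature.Probability.FitznerVanDerHofstad2017.RepulsiveTriangleExtractionIndep
import HarnessLib

/-!
# [FvdH17] §4.2 / [NoBLE17] (5.42): extraction for the repulsive square on independent configurations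

[FvdH17] §4.2 (arXiv:1506.07977v2 p. 36 = EJP 22 (2017) no. 43 p. 33), after (4.17): "where `ω₁, ω₂, ω₃` are
three i.i.d. percolation configurations under `ℙ_p`. The repulsive square `𝓢_{j₁,j₂,j₃,j₄}(x₁,x₂,x₃,x₄)` and pentagon
… are defined in the same manner. We omit the formal definitions of these diagrams."; and after (4.18): "We use the
same idea for the repulsive bubbles, triangles and squares … More details can be found in [NoBLE17, Section 5.3.2]",
whose (5.42) (PTRF 169 p. 1098) prints, for the same-configuration square,
`𝓢_{m₁,…,m₄}(x) ≤ Σ_{i=m_{1,4}}^{M−1} (1/6)∏_{s=1}^{3}(i−m_{1,4}+s) a_i(x) μ̄^i + (1/6)∏_{s=1}^{3}(M−m_{1,4}+s)(2dμ̄)^M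
(D^{⋆M}⋆G)(x) + ½(M−m_{1,4})(M−1−m_{1,4})(2dμ̄)^M (D^{⋆M}⋆G^{⋆2})(x) + (M−m_{1,4})(2dμ̄)^M (D^{⋆M}⋆G^{⋆3})(x)
+ (2dμ̄)^M (D^{⋆M}⋆G^{⋆4})(x)`.
The tree has (5.42) for the SAME-configuration member `diagS` (`RepulsiveSquareExtraction`, literature seat gen 12,
with the multiplicities counted in `RepulsivePolygonMultiplicities`) and, for members on several configurations, only
the simple bound (`pi_real_genDisjConnN_le_prod`).  This file proves the extraction bound for EVERY configuration
assignment `c : Fin 4 → Fin k` of the four lines, with the same right-hand side as `sum3_diagS_le_extraction`, and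
for the maximum over the assignments `(1, i, j, l)`, `(i,j,l) ∈ {1,…,4}³` on four i.i.d. configurations (the reading
"in the same manner" as (4.17); the print omits the formal definition — every other reading is a maximum of members
covered by `diagSL_le_extraction`), and feeds it to the hE-form slot theorem `sum3_le_repSquare_slots`.

## What is proved

* `sqLines`, `diagSL d k p c m₁ m₂ m₃ m₄ v y w x = ℙ_p^{⊗k}(⊛ of the four lines on configurations c 0, …, c 3)`,
  `repSquare` (the maximum above).
* CODING: `exists_trail_of_disjoint_paths₃` (the witness-level form of the triangle coding, derived from
  `exists_trail_of_mem_genDisjConnN_triLines` applied to the witness configurations themselves) and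
  `exists_trail_of_mem_genDisjConnN_sqLines` (append the fourth path): ONE bond-avoiding word `W` with junctions
  `W(r₁) = v`, `W(r₂) = y`, `W(r₃) = w`, `W(L) = x` whose four arcs are open on `ω_{c 0}, …, ω_{c 3}`.
* EXTRACTION (`mem_sqEventL_of_trail`) into the index set `idxAllS` of the same-configuration module, with BOXES of
  labelled pieces (`boxOf₄`; families `sqPiecesE/O/T2/T3/T4` with 4/5/6/7/8 pieces); MEASURE per box
  (`pi_real_pi_disjointOccurrenceList_le_prod`): `p^L`, `p^M τ`, `p^{M−m₄}p^{m₄} ττ`, `p^{M−m₃−m₄}p^{m₃}p^{m₄} τττ`,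
  `p^{M−m₂−m₃−m₄}p^{m₂}p^{m₃}p^{m₄} ττττ` — the five bounds of `diagS_le_extraction`; whence **`diagSL_le_extraction`**,
  **`repSquare_le_extraction`**, the `(v,y,w)`-summation stated once for any dominated `D`
  (`sum3_le_extractionS_of_pointwise`), **`sum3_diagSL_le_extraction`**, **`sum3_repSquare_le_extraction`** (+ the
  binomial form), and the SLOT forms **`sum3_diagSL_le_slots`**, **`sum3_repSquare_le_slots`**.

READING as in `GeneralizedDisjointOccurrence(N)`: PATH READING of `{v ←m→ w}`, bond-disjointness for "disjoint".
Nothing in this module is a cited hypothesis.  There is no printed pentagon analogue of (5.40)–(5.42) ([NoBLE17-I]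
§5.3.2 turns to weighted diagrams after (5.42)); none is asserted here.

## References
* [FvdH17] R. Fitzner, R. van der Hofstad, EJP 22 (2017) no. 43; arXiv:1506.07977v2 — §4.2 Def. 4.1, (4.13)–(4.15),
  (4.17) and the two sentences after it, (4.18) and the display after it (v2 pp. 35–36 = EJP p. 33).
* [NoBLE17] R. Fitzner, R. van der Hofstad, PTRF 169 (2017) 1041–1119 — §5.3.1 (5.35)–(5.38) p. 1097, §5.3.2 (5.39)
  p. 1097, (5.42) p. 1098.
-/

noncomputable section

namespace Literature.Probability.FitznerVanDerHofstad2017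

open _root_.MeasureTheory Literature.Probability.Percolation
open Literature.Probability.LatticeModels
open Literature.Barriers.CriticalPhenomena
open scoped BigOperators ENNReal

variable {d : ℕ}

/-! ### A. The labelled square and its maximum -/

/-- The four lines `{0 ←m₁→ v}_{c 0}, {v ←m₂→ y}_{c 1}, {y ←m₃→ w}_{c 2}, {w ←m₄→ x}_{c 3}` of the repulsive square.
[cite: FitznerVanDerHofstad2017, §4.2 (4.17) and the sentence after it (arXiv:1506.07977v2 p. 36 = EJP p. 33)] -/
def sqLines {k : ℕ} (c : Fin 4 → Fin k) (m₁ m₂ m₃ m₄ : ℕ) (v y w x : Site d) : Fin 4 → GDLine (Site d) k :=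
  ![⟨m₁, 0, v, c 0⟩, ⟨m₂, v, y, c 1⟩, ⟨m₃, y, w, c 2⟩, ⟨m₄, w, x, c 3⟩]

/-- **The square member on configurations `c`**:
`ℙ_p^{⊗k}({0 ←m₁→ v}_{c 0} ⊛ {v ←m₂→ y}_{c 1} ⊛ {y ←m₃→ w}_{c 2} ⊛ {w ←m₄→ x}_{c 3})`.
[cite: FitznerVanDerHofstad2017, §4.2 Def. 4.1, (4.17) and the sentence after it (arXiv:1506.07977v2 pp. 35–36 = EJP p. 33)] -/
def diagSL (d k : ℕ) (p : unitInterval) (c : Fin 4 → Fin k) (m₁ m₂ m₃ m₄ : ℕ) (v y w x : Site d) : ℝ :=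
  (Measure.pi (fun _ : Fin k => bondPercolation (zdGraph d) p)).real (genDisjConnN (sqLines c m₁ m₂ m₃ m₄ v y w x))

/-- `diagSL ≥ 0`. [folklore] -/
theorem diagSL_nonneg (k : ℕ) (p : unitInterval) (c : Fin 4 → Fin k) (m₁ m₂ m₃ m₄ : ℕ) (v y w x : Site d) :
    0 ≤ diagSL d k p c m₁ m₂ m₃ m₄ v y w x :=
  measureReal_nonneg

/-- **The repulsive square `𝓢_{m₁,…,m₄}(v,y,w,x)` read "in the same manner" as (4.17)**: the maximum over
`(i,j,l) ∈ {1,…,4}³` of the members with the first line on configuration `1` and the others on `i, j, l`, four i.i.d.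
configurations (the print omits the formal definition; every member of any such maximum is a `diagSL`).
[cite: FitznerVanDerHofstad2017, §4.2 (4.17) and the sentence after it (arXiv:1506.07977v2 p. 36 = EJP p. 33)] -/
def repSquare (d : ℕ) (p : unitInterval) (m₁ m₂ m₃ m₄ : ℕ) (v y w x : Site d) : ℝ :=
  Finset.univ.sup' Finset.univ_nonempty
    (fun ijl : Fin 4 × Fin 4 × Fin 4 => diagSL d 4 p ![0, ijl.1, ijl.2.1, ijl.2.2] m₁ m₂ m₃ m₄ v y w x)

/-! ### B. Coding -/

/-- **The triangle coding at the level of witnesses** (from `exists_trail_of_mem_genDisjConnN_triLines` applied to the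
three witness configurations themselves): three pairwise bond-disjoint lattice bond sets carrying open paths
`0 → v` (`≥ m₁` bonds), `v → y` (`≥ m₂`), `y → w` (`≥ m₃`) contain the three consecutive arcs of ONE bond-avoiding word.
[cite: FitznerVanDerHofstad2017, §4.2 Def. 4.1 (arXiv:1506.07977v2 p. 35 = EJP p. 33)]
[cite: FitznerVanDerHofstad2016NoBLE, §5.3.1 (5.35) PTRF p. 1097] -/
theorem exists_trail_of_disjoint_paths₃ {K₀ K₁ K₂ : Set (Sym2 (Site d))} (hE₀ : K₀ ⊆ (zdGraph d).edgeSet)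
    (hE₁ : K₁ ⊆ (zdGraph d).edgeSet) (hE₂ : K₂ ⊆ (zdGraph d).edgeSet) {m₁ m₂ m₃ : ℕ} {v y w : Site d}
    (h₀ : K₀ ∈ openConnGe m₁ (0 : Site d) v) (h₁ : K₁ ∈ openConnGe m₂ v y) (h₂ : K₂ ∈ openConnGe m₃ y w)
    (hd₀₁ : Disjoint K₀ K₁) (hd₀₂ : Disjoint K₀ K₂) (hd₁₂ : Disjoint K₁ K₂) :
    ∃ (L r₁ r₂ : ℕ) (W : Fin L → Fin d × Bool), IsTrail W ∧ m₁ ≤ r₁ ∧ r₁ + m₂ ≤ r₂ ∧ r₂ + m₃ ≤ L ∧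
      wordPos W r₁ = v ∧ wordPos W r₂ = y ∧ wordPos W L = w ∧
      (↑(wordArc W 0 r₁) : Set (Sym2 (Site d))) ⊆ K₀ ∧ (↑(wordArc W r₁ r₂) : Set (Sym2 (Site d))) ⊆ K₁ ∧
        (↑(wordArc W r₂ L) : Set (Sym2 (Site d))) ⊆ K₂ := by
  let ω' : Fin 3 → BondConfig (Site d) := ![K₀, K₁, K₂]
  have hω' : ∀ j, ω' j ⊆ (zdGraph d).edgeSet := by
    intro j
    fin_cases j
    · exact hE₀
    · exact hE₁
    · exact hE₂
  have hmem : ω' ∈ genDisjConnN (triLines labE m₁ m₂ m₃ v y w) := by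
    refine ⟨ω', ?_, ?_, ?_⟩
    · intro j
      fin_cases j
      · show K₀ ⊆ K₀
        exact Set.Subset.rfl
      · show K₁ ⊆ K₁
        exact Set.Subset.rfl
      · show K₂ ⊆ K₂
        exact Set.Subset.rfl
    · intro j
      fin_cases j
      · show K₀ ∈ openConnGe m₁ (0 : Site d) v
        exact h₀
      · show K₁ ∈ openConnGe m₂ v y
        exact h₁
      · show K₂ ∈ openConnGe m₃ y w
        exact h₂
    · intro i j hij
      fin_cases i <;> fin_cases j
      · exact absurd rfl hij
      · show Disjoint K₀ K₁
        exact hd₀₁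
      · show Disjoint K₀ K₂
        exact hd₀₂
      · show Disjoint K₁ K₀
        exact hd₀₁.symm
      · exact absurd rfl hij
      · show Disjoint K₁ K₂
        exact hd₁₂
      · show Disjoint K₂ K₀
        exact hd₀₂.symm
      · show Disjoint K₂ K₁
        exact hd₁₂.symm
      · exact absurd rfl hij
  obtain ⟨L, r₁, r₂, W, hW, hr₁, hr₁₂, hr₂L, hv, hy, hw, hA₀, hA₁, hA₂⟩ :=
    exists_trail_of_mem_genDisjConnN_triLines hω' hmem
  exact ⟨L, r₁, r₂, W, hW, hr₁, hr₁₂, hr₂L, hv, hy, hw, hA₀, hA₁, hA₂⟩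

/-- Arcs inside the first word of an appended pair. [folklore] -/
theorem wordArc_append_left {N N' : ℕ} (W : Fin N → Fin d × Bool) (u : Fin N' → Fin d × Bool) {a b : ℕ}
    (hb : b ≤ N) : wordArc (Fin.append W u) a b = wordArc W a b := by
  unfold wordArc
  refine Finset.image_congr fun i hi => ?_
  have hi' := (Finset.mem_Ico.1 (Finset.mem_coe.1 hi)).2
  exact wordEdge_append_of_lt W u (by omega)

/-- Every bond of a word lies in one of three consecutive arcs covering it. [folklore] -/
theorem mem_wordArc_cases₃ {N : ℕ} (W : Fin N → Fin d × Bool) (r₁ r₂ : ℕ) {e : Sym2 (Site d)}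
    (he : e ∈ wordEdges W) :
    e ∈ (↑(wordArc W 0 r₁) : Set (Sym2 (Site d))) ∨ e ∈ (↑(wordArc W r₁ r₂) : Set (Sym2 (Site d))) ∨
      e ∈ (↑(wordArc W r₂ N) : Set (Sym2 (Site d))) := by
  rw [wordEdges, Finset.mem_image] at he
  obtain ⟨i, hi, rfl⟩ := he
  rw [Finset.mem_range] at hi
  by_cases h₁ : i < r₁
  · exact Or.inl (Finset.mem_coe.2 (Finset.mem_image.2 ⟨i, Finset.mem_Ico.2 ⟨Nat.zero_le _, h₁⟩, rfl⟩))
  · by_cases h₂ : i < r₂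
    · exact Or.inr (Or.inl (Finset.mem_coe.2 (Finset.mem_image.2 ⟨i, Finset.mem_Ico.2 ⟨not_lt.1 h₁, h₂⟩, rfl⟩)))
    · exact Or.inr (Or.inr (Finset.mem_coe.2 (Finset.mem_image.2 ⟨i, Finset.mem_Ico.2 ⟨not_lt.1 h₂, hi⟩, rfl⟩)))

/-- **Coding of a labelled square member.**  If `ω ∈ ⊛` of the four lines of `sqLines c m₁ m₂ m₃ m₄ v y w x`
(lattice configurations), the four pairwise bond-disjoint open paths concatenate to ONE bond-avoiding word `W` of
length `L` with `W(r₁) = v`, `W(r₂) = y`, `W(r₃) = w`, `W(L) = x` (`m₁ ≤ r₁`, `r₁+m₂ ≤ r₂`, `r₂+m₃ ≤ r₃`, `r₃+m₄ ≤ L`),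
the arcs `[0,r₁)`, `[r₁,r₂)`, `[r₂,r₃)`, `[r₃,L)` open in `ω_{c 0}`, `ω_{c 1}`, `ω_{c 2}`, `ω_{c 3}`.
[cite: FitznerVanDerHofstad2017, §4.2 Def. 4.1, (4.17) and the sentence after it (arXiv:1506.07977v2 pp. 35–36 = EJP p. 33)]
[cite: FitznerVanDerHofstad2016NoBLE, §5.3.1 (5.35)–(5.38) PTRF p. 1097] -/
theorem exists_trail_of_mem_genDisjConnN_sqLines {k : ℕ} {c : Fin 4 → Fin k}
    {ω : Fin k → BondConfig (Site d)} (hω : ∀ j, ω j ⊆ (zdGraph d).edgeSet) {m₁ m₂ m₃ m₄ : ℕ}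
    {v y w x : Site d} (h : ω ∈ genDisjConnN (sqLines c m₁ m₂ m₃ m₄ v y w x)) :
    ∃ (L r₁ r₂ r₃ : ℕ) (W : Fin L → Fin d × Bool), IsTrail W ∧ m₁ ≤ r₁ ∧ r₁ + m₂ ≤ r₂ ∧ r₂ + m₃ ≤ r₃ ∧
      r₃ + m₄ ≤ L ∧ wordPos W r₁ = v ∧ wordPos W r₂ = y ∧ wordPos W r₃ = w ∧ wordPos W L = x ∧
      (↑(wordArc W 0 r₁) : Set (Sym2 (Site d))) ⊆ ω (c 0) ∧ (↑(wordArc W r₁ r₂) : Set (Sym2 (Site d))) ⊆ ω (c 1) ∧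
        (↑(wordArc W r₂ r₃) : Set (Sym2 (Site d))) ⊆ ω (c 2) ∧
          (↑(wordArc W r₃ L) : Set (Sym2 (Site d))) ⊆ ω (c 3) := by
  classical
  obtain ⟨K, hKω, hKev, hdisj⟩ := h
  have hK0 : K 0 ⊆ ω (c 0) := by simpa [sqLines] using hKω 0
  have hK1 : K 1 ⊆ ω (c 1) := by simpa [sqLines] using hKω 1
  have hK2 : K 2 ⊆ ω (c 2) := by simpa [sqLines] using hKω 2
  have hK3 : K 3 ⊆ ω (c 3) := by simpa [sqLines] using hKω 3
  have hev0 : K 0 ∈ openConnGe m₁ (0 : Site d) v := by simpa [sqLines, GDLine.event] using hKev 0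
  have hev1 : K 1 ∈ openConnGe m₂ v y := by simpa [sqLines, GDLine.event] using hKev 1
  have hev2 : K 2 ∈ openConnGe m₃ y w := by simpa [sqLines, GDLine.event] using hKev 2
  obtain ⟨P₃, hP₃, hm₃⟩ : K 3 ∈ openConnGe m₄ w x := by simpa [sqLines, GDLine.event] using hKev 3
  have hd01 : Disjoint (K 0) (K 1) := hdisj (by decide)
  have hd02 : Disjoint (K 0) (K 2) := hdisj (by decide)
  have hd12 : Disjoint (K 1) (K 2) := hdisj (by decide)
  have hd03 : Disjoint (K 0) (K 3) := hdisj (by decide)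
  have hd13 : Disjoint (K 1) (K 3) := hdisj (by decide)
  have hd23 : Disjoint (K 2) (K 3) := hdisj (by decide)
  obtain ⟨L', r₁, r₂, W', hW', hr₁, hr₁₂, hr₂L', hv, hy, hw, hA0, hA1, hA2⟩ :=
    exists_trail_of_disjoint_paths₃ (hK0.trans (hω _)) (hK1.trans (hω _)) (hK2.trans (hω _)) hev0 hev1 hev2
      hd01 hd02 hd12
  obtain ⟨u₃, hu₃, hpos₃, hedges₃⟩ := exists_sawWord_at (hK3.trans (hω _)) P₃ hP₃
  have hx : w + wordPos u₃ P₃.length = x := by rw [hpos₃ _ le_rfl, SimpleGraph.Walk.getVert_length]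
  have hmem₃ : ∀ {f : Sym2 (Site d)}, f ∈ wordEdges u₃ → Sym2.map (fun z => w + z) f ∈ K 3 := fun {f} hf =>
    hedges₃ (by rw [Finset.coe_image]; exact Set.mem_image_of_mem _ (Finset.mem_coe.2 hf))
  -- every bond of `W'` lies in `K 0 ∪ K 1 ∪ K 2`
  have hmemW : ∀ {e : Sym2 (Site d)}, e ∈ wordEdges W' → e ∈ K 0 ∨ e ∈ K 1 ∨ e ∈ K 2 := by
    intro e he
    rcases mem_wordArc_cases₃ W' r₁ r₂ he with h0 | h1 | h2
    · exact Or.inl (hA0 h0)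
    · exact Or.inr (Or.inl (hA1 h1))
    · exact Or.inr (Or.inr (hA2 h2))
  refine ⟨L' + P₃.length, r₁, r₂, L', Fin.append W' u₃, ?_, hr₁, hr₁₂, hr₂L', by omega, ?_, ?_, ?_, ?_, ?_, ?_,
    ?_, ?_⟩
  · rw [isTrail_append_iff]
    refine ⟨hW', isTrail_of_isSAW hu₃, ?_⟩
    rw [BondDisjointPair, shiftedWordEdges, hw]
    refine Finset.disjoint_left.2 fun e he he' => ?_
    rw [Finset.mem_image] at he'
    obtain ⟨f, hf, rfl⟩ := he'
    have h3 := hmem₃ hf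
    rcases hmemW he with h0 | h1 | h2
    · exact Set.disjoint_left.1 hd03 h0 h3
    · exact Set.disjoint_left.1 hd13 h1 h3
    · exact Set.disjoint_left.1 hd23 h2 h3
  · rw [wordPos_append_of_le W' u₃ (by omega : r₁ ≤ L'), hv]
  · rw [wordPos_append_of_le W' u₃ (by omega : r₂ ≤ L'), hy]
  · rw [wordPos_append_of_le W' u₃ le_rfl, hw]
  · rw [wordPos_append_add W' u₃ le_rfl, hw, hx]
  · rw [wordArc_append_left W' u₃ (by omega : r₁ ≤ L')]
    exact hA0.trans hK0
  · rw [wordArc_append_left W' u₃ (by omega : r₂ ≤ L')]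
    exact hA1.trans hK1
  · rw [wordArc_append_left W' u₃ le_rfl]
    exact hA2.trans hK2
  · intro e he
    rw [Finset.mem_coe, wordArc, Finset.mem_image] at he
    obtain ⟨i, hi, rfl⟩ := he
    rw [Finset.mem_Ico] at hi
    obtain ⟨j, rfl⟩ := Nat.exists_eq_add_of_le hi.1
    rw [wordEdge_append_add W' u₃ (by omega : j < P₃.length), hw]
    exact hK3 (hmem₃ (Finset.mem_image.2 ⟨j, Finset.mem_range.2 (by omega), rfl⟩))

/-! ### C. The extraction events: boxes of labelled pieces -/

section Pieces

variable {k : ℕ}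

/-- The BOX of labelled pieces for four lines: on each configuration `c'`, the pieces `A_j` sitting on a line with
`c (lab j) = c'` occur bond-disjointly. [cite: FitznerVanDerHofstad2017, §4.2 Def. 4.1, remark after (4.13) (arXiv:1506.07977v2 p. 35)] -/
def boxOf₄ {q : ℕ} (A : Fin q → Set (BondConfig (Site d))) (lab : Fin q → Fin 4) (c : Fin 4 → Fin k) :
    Set (Fin k → BondConfig (Site d)) :=
  Set.pi Set.univ fun c' => disjointOccurrenceList (eventsAt A (c ∘ lab) c')

/-- Explicit family: the four arcs `[0,r₁)`, `[r₁,r₂)`, `[r₂,r₃)`, `[r₃,L)` of `W` as cylinders. [folklore] -/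
def sqPiecesE {L : ℕ} (W : Fin L → Fin d × Bool) (r₁ r₂ r₃ : ℕ) : Fin 4 → Set (BondConfig (Site d)) :=
  ![bondsOpen (wordArc W 0 r₁), bondsOpen (wordArc W r₁ r₂), bondsOpen (wordArc W r₂ r₃), bondsOpen (wordArc W r₃ L)]

/-- One-tail family: the arcs `[0,r₁)`, `[r₁,r₂)`, `[r₂,r₃)`, `[r₃,M)` of `u` and the tail `{u(M) ↔ x}`. [folklore] -/
def sqPiecesO {M : ℕ} (u : Fin M → Fin d × Bool) (r₁ r₂ r₃ : ℕ) (x : Site d) : Fin 5 → Set (BondConfig (Site d)) :=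
  ![bondsOpen (wordArc u 0 r₁), bondsOpen (wordArc u r₁ r₂), bondsOpen (wordArc u r₂ r₃), bondsOpen (wordArc u r₃ M),
    openConn (wordPos u M) x]

/-- Two-tail family: arcs `[0,r₁)`, `[r₁,r₂)`, `[r₂,M−m₄)` of `u₁`, tail `{u₁(M−m₄) ↔ w}`, cylinder of `u₄` at `w`,
tail `{w + u₄(m₄) ↔ x}`. [folklore] -/
def sqPiecesT2 {M m₄ : ℕ} (u₁ : Fin (M - m₄) → Fin d × Bool) (r₁ r₂ : ℕ) (u₄ : Fin m₄ → Fin d × Bool)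
    (x w : Site d) : Fin 6 → Set (BondConfig (Site d)) :=
  ![bondsOpen (wordArc u₁ 0 r₁), bondsOpen (wordArc u₁ r₁ r₂), bondsOpen (wordArc u₁ r₂ (M - m₄)),
    openConn (wordPos u₁ (M - m₄)) w, wordOpenAt w u₄, openConn (w + wordPos u₄ m₄) x]

/-- Three-tail family: arcs `[0,r₁)`, `[r₁,M−m₃−m₄)` of `u₁`, tail to `y`, cylinder of `u₃` at `y`, tail to `w`,
cylinder of `u₄` at `w`, tail to `x`. [folklore] -/
def sqPiecesT3 {M m₃ m₄ : ℕ} (u₁ : Fin (M - (m₃ + m₄)) → Fin d × Bool) (r₁ : ℕ) (u₃ : Fin m₃ → Fin d × Bool)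
    (u₄ : Fin m₄ → Fin d × Bool) (x y w : Site d) : Fin 7 → Set (BondConfig (Site d)) :=
  ![bondsOpen (wordArc u₁ 0 r₁), bondsOpen (wordArc u₁ r₁ (M - (m₃ + m₄))), openConn (wordPos u₁ (M - (m₃ + m₄))) y,
    wordOpenAt y u₃, openConn (y + wordPos u₃ m₃) w, wordOpenAt w u₄, openConn (w + wordPos u₄ m₄) x]

/-- Four-tail family: cylinder of `u₁`, tail to `v`, cylinder of `u₂` at `v`, tail to `y`, cylinder of `u₃` at `y`,
tail to `w`, cylinder of `u₄` at `w`, tail to `x`. [folklore] -/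
def sqPiecesT4 {M m₂ m₃ m₄ : ℕ} (u₁ : Fin (M - (m₂ + m₃ + m₄)) → Fin d × Bool) (u₂ : Fin m₂ → Fin d × Bool)
    (u₃ : Fin m₃ → Fin d × Bool) (u₄ : Fin m₄ → Fin d × Bool) (x v y w : Site d) :
    Fin 8 → Set (BondConfig (Site d)) :=
  ![wordOpen u₁, openConn (wordPos u₁ (M - (m₂ + m₃ + m₄))) v, wordOpenAt v u₂, openConn (v + wordPos u₂ m₂) y,
    wordOpenAt y u₃, openConn (y + wordPos u₃ m₃) w, wordOpenAt w u₄, openConn (w + wordPos u₄ m₄) x]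

/-- Lines of the explicit pieces. [folklore] -/
def sqLabE : Fin 4 → Fin 4 := ![0, 1, 2, 3]
/-- Lines of the one-tail pieces. [folklore] -/
def sqLabO : Fin 5 → Fin 4 := ![0, 1, 2, 3, 3]
/-- Lines of the two-tail pieces. [folklore] -/
def sqLabT2 : Fin 6 → Fin 4 := ![0, 1, 2, 2, 3, 3]
/-- Lines of the three-tail pieces. [folklore] -/
def sqLabT3 : Fin 7 → Fin 4 := ![0, 1, 1, 2, 2, 3, 3]
/-- Lines of the four-tail pieces. [folklore] -/
def sqLabT4 : Fin 8 → Fin 4 := ![0, 0, 1, 1, 2, 2, 3, 3]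

/-- The product-space event attached to an index of the square extraction (labelled version of `sqEvent`).
[folklore] -/
def sqEventL (c : Fin 4 → Fin k) (m₂ m₃ m₄ M : ℕ) (x v y w : Site d) :
    SqIdx d m₂ m₃ m₄ M → Set (Fin k → BondConfig (Site d))
  | Sum.inl ⟨_, (W, r₁, r₂, r₃)⟩ => boxOf₄ (sqPiecesE W r₁ r₂ r₃) sqLabE c
  | Sum.inr (Sum.inl (u, r₁, r₂, r₃)) => boxOf₄ (sqPiecesO u r₁ r₂ r₃ x) sqLabO c
  | Sum.inr (Sum.inr (Sum.inl ((u₁, r₁, r₂), u₄))) => boxOf₄ (sqPiecesT2 u₁ r₁ r₂ u₄ x w) sqLabT2 c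
  | Sum.inr (Sum.inr (Sum.inr (Sum.inl ((u₁, r₁), u₃, u₄)))) => boxOf₄ (sqPiecesT3 u₁ r₁ u₃ u₄ x y w) sqLabT3 c
  | Sum.inr (Sum.inr (Sum.inr (Sum.inr (u₁, u₂, u₃, u₄)))) => boxOf₄ (sqPiecesT4 u₁ u₂ u₃ u₄ x v y w) sqLabT4 c

/-- The explicit pieces are increasing events. [folklore] -/
theorem sqPiecesE_upper {L : ℕ} (W : Fin L → Fin d × Bool) (r₁ r₂ r₃ : ℕ) :
    ∀ j, IsUpperSet (sqPiecesE W r₁ r₂ r₃ j) := by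
  intro j
  fin_cases j
  exacts [isUpperSet_bondsOpen _, isUpperSet_bondsOpen _, isUpperSet_bondsOpen _, isUpperSet_bondsOpen _]

/-- The explicit pieces are finitary events. [folklore] -/
theorem sqPiecesE_finitary {L : ℕ} (W : Fin L → Fin d × Bool) (r₁ r₂ r₃ : ℕ) :
    ∀ j, IsFinitary (sqPiecesE W r₁ r₂ r₃ j) := by
  intro j
  fin_cases j
  exacts [isFinitary_bondsOpen _, isFinitary_bondsOpen _, isFinitary_bondsOpen _, isFinitary_bondsOpen _]

/-- The one-tail pieces are increasing events. [folklore] -/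
theorem sqPiecesO_upper {M : ℕ} (u : Fin M → Fin d × Bool) (r₁ r₂ r₃ : ℕ) (x : Site d) :
    ∀ j, IsUpperSet (sqPiecesO u r₁ r₂ r₃ x j) := by
  intro j
  fin_cases j
  exacts [isUpperSet_bondsOpen _, isUpperSet_bondsOpen _, isUpperSet_bondsOpen _, isUpperSet_bondsOpen _,
    isUpperSet_openConn _ _]

/-- The one-tail pieces are finitary events. [folklore] -/
theorem sqPiecesO_finitary {M : ℕ} (u : Fin M → Fin d × Bool) (r₁ r₂ r₃ : ℕ) (x : Site d) :
    ∀ j, IsFinitary (sqPiecesO u r₁ r₂ r₃ x j) := by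
  classical
  intro j
  fin_cases j
  exacts [isFinitary_bondsOpen _, isFinitary_bondsOpen _, isFinitary_bondsOpen _, isFinitary_bondsOpen _,
    isFinitary_openConn _ _]

/-- The two-tail pieces are increasing events. [folklore] -/
theorem sqPiecesT2_upper {M m₄ : ℕ} (u₁ : Fin (M - m₄) → Fin d × Bool) (r₁ r₂ : ℕ) (u₄ : Fin m₄ → Fin d × Bool)
    (x w : Site d) : ∀ j, IsUpperSet (sqPiecesT2 u₁ r₁ r₂ u₄ x w j) := by
  intro j
  fin_cases j
  exacts [isUpperSet_bondsOpen _, isUpperSet_bondsOpen _, isUpperSet_bondsOpen _, isUpperSet_openConn _ _,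
    isUpperSet_wordOpenAt _ _, isUpperSet_openConn _ _]

/-- The two-tail pieces are finitary events. [folklore] -/
theorem sqPiecesT2_finitary {M m₄ : ℕ} (u₁ : Fin (M - m₄) → Fin d × Bool) (r₁ r₂ : ℕ) (u₄ : Fin m₄ → Fin d × Bool)
    (x w : Site d) : ∀ j, IsFinitary (sqPiecesT2 u₁ r₁ r₂ u₄ x w j) := by
  classical
  intro j
  fin_cases j
  exacts [isFinitary_bondsOpen _, isFinitary_bondsOpen _, isFinitary_bondsOpen _, isFinitary_openConn _ _,
    isFinitary_wordOpenAt _ _, isFinitary_openConn _ _]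

/-- The three-tail pieces are increasing events. [folklore] -/
theorem sqPiecesT3_upper {M m₃ m₄ : ℕ} (u₁ : Fin (M - (m₃ + m₄)) → Fin d × Bool) (r₁ : ℕ)
    (u₃ : Fin m₃ → Fin d × Bool) (u₄ : Fin m₄ → Fin d × Bool) (x y w : Site d) :
    ∀ j, IsUpperSet (sqPiecesT3 u₁ r₁ u₃ u₄ x y w j) := by
  intro j
  fin_cases j
  exacts [isUpperSet_bondsOpen _, isUpperSet_bondsOpen _, isUpperSet_openConn _ _, isUpperSet_wordOpenAt _ _,
    isUpperSet_openConn _ _, isUpperSet_wordOpenAt _ _, isUpperSet_openConn _ _]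

/-- The three-tail pieces are finitary events. [folklore] -/
theorem sqPiecesT3_finitary {M m₃ m₄ : ℕ} (u₁ : Fin (M - (m₃ + m₄)) → Fin d × Bool) (r₁ : ℕ)
    (u₃ : Fin m₃ → Fin d × Bool) (u₄ : Fin m₄ → Fin d × Bool) (x y w : Site d) :
    ∀ j, IsFinitary (sqPiecesT3 u₁ r₁ u₃ u₄ x y w j) := by
  classical
  intro j
  fin_cases j
  exacts [isFinitary_bondsOpen _, isFinitary_bondsOpen _, isFinitary_openConn _ _, isFinitary_wordOpenAt _ _,
    isFinitary_openConn _ _, isFinitary_wordOpenAt _ _, isFinitary_openConn _ _]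

/-- The four-tail pieces are increasing events. [folklore] -/
theorem sqPiecesT4_upper {M m₂ m₃ m₄ : ℕ} (u₁ : Fin (M - (m₂ + m₃ + m₄)) → Fin d × Bool)
    (u₂ : Fin m₂ → Fin d × Bool) (u₃ : Fin m₃ → Fin d × Bool) (u₄ : Fin m₄ → Fin d × Bool) (x v y w : Site d) :
    ∀ j, IsUpperSet (sqPiecesT4 u₁ u₂ u₃ u₄ x v y w j) := by
  intro j
  fin_cases j
  exacts [isUpperSet_wordOpen _, isUpperSet_openConn _ _, isUpperSet_wordOpenAt _ _, isUpperSet_openConn _ _,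
    isUpperSet_wordOpenAt _ _, isUpperSet_openConn _ _, isUpperSet_wordOpenAt _ _, isUpperSet_openConn _ _]

/-- The four-tail pieces are finitary events. [folklore] -/
theorem sqPiecesT4_finitary {M m₂ m₃ m₄ : ℕ} (u₁ : Fin (M - (m₂ + m₃ + m₄)) → Fin d × Bool)
    (u₂ : Fin m₂ → Fin d × Bool) (u₃ : Fin m₃ → Fin d × Bool) (u₄ : Fin m₄ → Fin d × Bool) (x v y w : Site d) :
    ∀ j, IsFinitary (sqPiecesT4 u₁ u₂ u₃ u₄ x v y w j) := by
  classical
  intro j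
  fin_cases j
  exacts [isFinitary_wordOpen _, isFinitary_openConn _ _, isFinitary_wordOpenAt _ _, isFinitary_openConn _ _,
    isFinitary_wordOpenAt _ _, isFinitary_openConn _ _, isFinitary_wordOpenAt _ _, isFinitary_openConn _ _]

end Pieces

/-! ### D. Extraction: an open labelled trail lies in one of the boxes -/

section Extraction

variable {k : ℕ} (c : Fin 4 → Fin k)

/-- **Explicit piece**: `L < M`. [cite: FitznerVanDerHofstad2016NoBLE, §5.3.2 (5.42) PTRF p. 1098] -/
theorem mem_sqBoxE_of_trail {ω : Fin k → BondConfig (Site d)} {L r₁ r₂ r₃ : ℕ} {W : Fin L → Fin d × Bool}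
    (hW : IsTrail W) (hr₁₂ : r₁ ≤ r₂) (hr₂₃ : r₂ ≤ r₃) (hr₃L : r₃ ≤ L)
    (h0 : (↑(wordArc W 0 r₁) : Set (Sym2 (Site d))) ⊆ ω (c 0))
    (h1 : (↑(wordArc W r₁ r₂) : Set (Sym2 (Site d))) ⊆ ω (c 1))
    (h2 : (↑(wordArc W r₂ r₃) : Set (Sym2 (Site d))) ⊆ ω (c 2))
    (h3 : (↑(wordArc W r₃ L) : Set (Sym2 (Site d))) ⊆ ω (c 3)) :
    ω ∈ boxOf₄ (sqPiecesE W r₁ r₂ r₃) sqLabE c := by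
  let t : Fin 5 → ℕ := ![0, r₁, r₂, r₃, L]
  refine mem_pi_disjointOccurrenceList_of_witnesses (sqPiecesE W r₁ r₂ r₃) (c ∘ sqLabE) (sqPiecesE_upper W r₁ r₂ r₃)
    (fun j => (↑(wordArc W (t j.castSucc) (t j.succ)) : Set (Sym2 (Site d)))) ?_ ?_
    (pairwise_disjoint_wordArc_cuts hW t ?_ le_rfl)
  · intro j
    fin_cases j
    · exact h0
    · exact h1
    · exact h2
    · exact h3
  · intro j
    fin_cases j
    · show (↑(wordArc W 0 r₁) : Set (Sym2 (Site d))) ∈ bondsOpen (wordArc W 0 r₁)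
      exact (mem_bondsOpen _ _).2 subset_rfl
    · show (↑(wordArc W r₁ r₂) : Set (Sym2 (Site d))) ∈ bondsOpen (wordArc W r₁ r₂)
      exact (mem_bondsOpen _ _).2 subset_rfl
    · show (↑(wordArc W r₂ r₃) : Set (Sym2 (Site d))) ∈ bondsOpen (wordArc W r₂ r₃)
      exact (mem_bondsOpen _ _).2 subset_rfl
    · show (↑(wordArc W r₃ L) : Set (Sym2 (Site d))) ∈ bondsOpen (wordArc W r₃ L)
      exact (mem_bondsOpen _ _).2 subset_rfl
  · intro i
    fin_cases i
    · show 0 ≤ r₁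
      exact Nat.zero_le _
    · show r₁ ≤ r₂
      exact hr₁₂
    · show r₂ ≤ r₃
      exact hr₂₃
    · show r₃ ≤ L
      exact hr₃L

/-- **One-tail piece**: `M ≤ L`, `r₃ ≤ M`: the arcs `[0,r₁)`, `[r₁,r₂)`, `[r₂,r₃)`, `[r₃,M)` of `u = W|[0,M)` and the
tail `W(M) → x` (arc `[M,L)`). [cite: FitznerVanDerHofstad2016NoBLE, §5.3.2 (5.42) PTRF p. 1098] -/
theorem mem_sqBoxO_of_trail {ω : Fin k → BondConfig (Site d)} {L M r₁ r₂ r₃ : ℕ} {x : Site d}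
    {W : Fin L → Fin d × Bool} (hW : IsTrail W) (hLM : M ≤ L) (hr₁₂ : r₁ ≤ r₂) (hr₂₃ : r₂ ≤ r₃) (hr₃M : r₃ ≤ M)
    (hx : wordPos W L = x)
    (h0 : (↑(wordArc W 0 r₁) : Set (Sym2 (Site d))) ⊆ ω (c 0))
    (h1 : (↑(wordArc W r₁ r₂) : Set (Sym2 (Site d))) ⊆ ω (c 1))
    (h2 : (↑(wordArc W r₂ r₃) : Set (Sym2 (Site d))) ⊆ ω (c 2))
    (h3 : (↑(wordArc W r₃ L) : Set (Sym2 (Site d))) ⊆ ω (c 3)) :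
    ω ∈ boxOf₄ (sqPiecesO (wordTake W M hLM) r₁ r₂ r₃ x) sqLabO c := by
  let t : Fin 6 → ℕ := ![0, r₁, r₂, r₃, M, L]
  refine mem_pi_disjointOccurrenceList_of_witnesses (sqPiecesO (wordTake W M hLM) r₁ r₂ r₃ x) (c ∘ sqLabO)
    (sqPiecesO_upper _ r₁ r₂ r₃ x) (fun j => (↑(wordArc W (t j.castSucc) (t j.succ)) : Set (Sym2 (Site d)))) ?_ ?_
    (pairwise_disjoint_wordArc_cuts hW t ?_ le_rfl)
  · intro j
    fin_cases j
    · exact h0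
    · exact h1
    · exact h2
    · show (↑(wordArc W r₃ M) : Set (Sym2 (Site d))) ⊆ ω (c 3)
      exact (Finset.coe_subset.2 (wordArc_sub W le_rfl hLM)).trans h3
    · show (↑(wordArc W M L) : Set (Sym2 (Site d))) ⊆ ω (c 3)
      exact (Finset.coe_subset.2 (wordArc_sub W hr₃M le_rfl)).trans h3
  · intro j
    fin_cases j
    · show (↑(wordArc W 0 r₁) : Set (Sym2 (Site d))) ∈ bondsOpen (wordArc (wordTake W M hLM) 0 r₁)
      rw [mem_bondsOpen, wordArc_wordTake W hLM (hr₁₂.trans (hr₂₃.trans hr₃M))]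
    · show (↑(wordArc W r₁ r₂) : Set (Sym2 (Site d))) ∈ bondsOpen (wordArc (wordTake W M hLM) r₁ r₂)
      rw [mem_bondsOpen, wordArc_wordTake W hLM (hr₂₃.trans hr₃M)]
    · show (↑(wordArc W r₂ r₃) : Set (Sym2 (Site d))) ∈ bondsOpen (wordArc (wordTake W M hLM) r₂ r₃)
      rw [mem_bondsOpen, wordArc_wordTake W hLM hr₃M]
    · show (↑(wordArc W r₃ M) : Set (Sym2 (Site d))) ∈ bondsOpen (wordArc (wordTake W M hLM) r₃ M)
      rw [mem_bondsOpen, wordArc_wordTake W hLM le_rfl]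
    · show (↑(wordArc W M L) : Set (Sym2 (Site d))) ∈ openConn (wordPos (wordTake W M hLM) M) x
      rw [wordPos_wordTake W hLM le_rfl, ← hx]
      exact wordArc_mem_openConn W hLM le_rfl
  · intro i
    fin_cases i
    · show 0 ≤ r₁
      exact Nat.zero_le _
    · show r₁ ≤ r₂
      exact hr₁₂
    · show r₂ ≤ r₃
      exact hr₂₃
    · show r₃ ≤ M
      exact hr₃M
    · show M ≤ L
      exact hLM

/-- **Two-tail piece**: `r₂ ≤ M − m₄ ≤ r₃`, `r₃ + m₄ ≤ L`: arcs `[0,r₁)`, `[r₁,r₂)`, `[r₂,M−m₄)` of `u₁ = W|[0,M−m₄)`,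
the tail `W(M−m₄) → w` (arc `[M−m₄,r₃)`), the `m₄` bonds after `w`, the tail `W(r₃+m₄) → x`.
[cite: FitznerVanDerHofstad2016NoBLE, §5.3.2 (5.42) PTRF p. 1098] -/
theorem mem_sqBoxT2_of_trail {ω : Fin k → BondConfig (Site d)} {L M m₄ r₁ r₂ r₃ : ℕ} {w x : Site d}
    {W : Fin L → Fin d × Bool} (hW : IsTrail W) (hr₁₂ : r₁ ≤ r₂) (hr₂M : r₂ ≤ M - m₄) (hMr₃ : M - m₄ ≤ r₃)
    (hr₃L : r₃ + m₄ ≤ L) (hML : M - m₄ ≤ L) (hw : wordPos W r₃ = w) (hx : wordPos W L = x)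
    (h0 : (↑(wordArc W 0 r₁) : Set (Sym2 (Site d))) ⊆ ω (c 0))
    (h1 : (↑(wordArc W r₁ r₂) : Set (Sym2 (Site d))) ⊆ ω (c 1))
    (h2 : (↑(wordArc W r₂ r₃) : Set (Sym2 (Site d))) ⊆ ω (c 2))
    (h3 : (↑(wordArc W r₃ L) : Set (Sym2 (Site d))) ⊆ ω (c 3)) :
    ω ∈ boxOf₄ (sqPiecesT2 (wordTake W (M - m₄) hML) r₁ r₂ (wordSeg W r₃ m₄ hr₃L) x w) sqLabT2 c := by
  have hp₁ : wordPos (wordTake W (M - m₄) hML) (M - m₄) = wordPos W (M - m₄) := wordPos_wordTake W hML le_rfl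
  have hp₄ : w + wordPos (wordSeg W r₃ m₄ hr₃L) m₄ = wordPos W (r₃ + m₄) := by
    rw [← hw, wordPos_wordSeg W hr₃L le_rfl]
  have hW₄ : (wordEdges (wordSeg W r₃ m₄ hr₃L)).image (Sym2.map fun z => w + z) = wordArc W r₃ (r₃ + m₄) := by
    rw [← hw, image_wordEdges_wordSeg W hr₃L]
  let t : Fin 7 → ℕ := ![0, r₁, r₂, M - m₄, r₃, r₃ + m₄, L]
  refine mem_pi_disjointOccurrenceList_of_witnesses _ (c ∘ sqLabT2) (sqPiecesT2_upper _ r₁ r₂ _ x w)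
    (fun j => (↑(wordArc W (t j.castSucc) (t j.succ)) : Set (Sym2 (Site d)))) ?_ ?_
    (pairwise_disjoint_wordArc_cuts hW t ?_ le_rfl)
  · intro j
    fin_cases j
    · exact h0
    · exact h1
    · show (↑(wordArc W r₂ (M - m₄)) : Set (Sym2 (Site d))) ⊆ ω (c 2)
      exact (Finset.coe_subset.2 (wordArc_sub W le_rfl hMr₃)).trans h2
    · show (↑(wordArc W (M - m₄) r₃) : Set (Sym2 (Site d))) ⊆ ω (c 2)
      exact (Finset.coe_subset.2 (wordArc_sub W hr₂M le_rfl)).trans h2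
    · show (↑(wordArc W r₃ (r₃ + m₄)) : Set (Sym2 (Site d))) ⊆ ω (c 3)
      exact (Finset.coe_subset.2 (wordArc_sub W le_rfl hr₃L)).trans h3
    · show (↑(wordArc W (r₃ + m₄) L) : Set (Sym2 (Site d))) ⊆ ω (c 3)
      exact (Finset.coe_subset.2 (wordArc_sub W (Nat.le_add_right _ _) le_rfl)).trans h3
  · intro j
    fin_cases j
    · show (↑(wordArc W 0 r₁) : Set (Sym2 (Site d))) ∈ bondsOpen (wordArc (wordTake W (M - m₄) hML) 0 r₁)
      rw [mem_bondsOpen, wordArc_wordTake W hML (hr₁₂.trans hr₂M)]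
    · show (↑(wordArc W r₁ r₂) : Set (Sym2 (Site d))) ∈ bondsOpen (wordArc (wordTake W (M - m₄) hML) r₁ r₂)
      rw [mem_bondsOpen, wordArc_wordTake W hML hr₂M]
    · show (↑(wordArc W r₂ (M - m₄)) : Set (Sym2 (Site d))) ∈
        bondsOpen (wordArc (wordTake W (M - m₄) hML) r₂ (M - m₄))
      rw [mem_bondsOpen, wordArc_wordTake W hML le_rfl]
    · show (↑(wordArc W (M - m₄) r₃) : Set (Sym2 (Site d))) ∈ openConn (wordPos (wordTake W (M - m₄) hML) (M - m₄)) w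
      rw [hp₁, ← hw]
      exact wordArc_mem_openConn W hMr₃ (by omega)
    · show (↑(wordArc W r₃ (r₃ + m₄)) : Set (Sym2 (Site d))) ∈ wordOpenAt w (wordSeg W r₃ m₄ hr₃L)
      rw [mem_wordOpenAt, hW₄]
    · show (↑(wordArc W (r₃ + m₄) L) : Set (Sym2 (Site d))) ∈ openConn (w + wordPos (wordSeg W r₃ m₄ hr₃L) m₄) x
      rw [hp₄, ← hx]
      exact wordArc_mem_openConn W hr₃L le_rfl
  · intro i
    fin_cases i
    · show 0 ≤ r₁
      exact Nat.zero_le _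
    · show r₁ ≤ r₂
      exact hr₁₂
    · show r₂ ≤ M - m₄
      exact hr₂M
    · show M - m₄ ≤ r₃
      exact hMr₃
    · show r₃ ≤ r₃ + m₄
      exact Nat.le_add_right _ _
    · show r₃ + m₄ ≤ L
      exact hr₃L

/-- **Three-tail piece**: `r₁ ≤ M − m₃ − m₄ ≤ r₂`, `r₂ + m₃ ≤ r₃`, `r₃ + m₄ ≤ L` (seven arcs of `W`).
[cite: FitznerVanDerHofstad2016NoBLE, §5.3.2 (5.42) PTRF p. 1098] -/
theorem mem_sqBoxT3_of_trail {ω : Fin k → BondConfig (Site d)} {L M m₃ m₄ r₁ r₂ r₃ : ℕ} {y w x : Site d}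
    {W : Fin L → Fin d × Bool} (hW : IsTrail W) (hr₁M : r₁ ≤ M - (m₃ + m₄)) (hMr₂ : M - (m₃ + m₄) ≤ r₂)
    (hr₂₃ : r₂ + m₃ ≤ r₃) (hr₃L : r₃ + m₄ ≤ L) (hML : M - (m₃ + m₄) ≤ L) (hr₂L : r₂ + m₃ ≤ L)
    (hy : wordPos W r₂ = y) (hw : wordPos W r₃ = w) (hx : wordPos W L = x)
    (h0 : (↑(wordArc W 0 r₁) : Set (Sym2 (Site d))) ⊆ ω (c 0))
    (h1 : (↑(wordArc W r₁ r₂) : Set (Sym2 (Site d))) ⊆ ω (c 1))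
    (h2 : (↑(wordArc W r₂ r₃) : Set (Sym2 (Site d))) ⊆ ω (c 2))
    (h3 : (↑(wordArc W r₃ L) : Set (Sym2 (Site d))) ⊆ ω (c 3)) :
    ω ∈ boxOf₄ (sqPiecesT3 (wordTake W (M - (m₃ + m₄)) hML) r₁ (wordSeg W r₂ m₃ hr₂L) (wordSeg W r₃ m₄ hr₃L) x y w)
      sqLabT3 c := by
  have hp₁ : wordPos (wordTake W (M - (m₃ + m₄)) hML) (M - (m₃ + m₄)) = wordPos W (M - (m₃ + m₄)) :=
    wordPos_wordTake W hML le_rfl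
  have hp₃ : y + wordPos (wordSeg W r₂ m₃ hr₂L) m₃ = wordPos W (r₂ + m₃) := by
    rw [← hy, wordPos_wordSeg W hr₂L le_rfl]
  have hp₄ : w + wordPos (wordSeg W r₃ m₄ hr₃L) m₄ = wordPos W (r₃ + m₄) := by
    rw [← hw, wordPos_wordSeg W hr₃L le_rfl]
  have hW₃ : (wordEdges (wordSeg W r₂ m₃ hr₂L)).image (Sym2.map fun z => y + z) = wordArc W r₂ (r₂ + m₃) := by
    rw [← hy, image_wordEdges_wordSeg W hr₂L]
  have hW₄ : (wordEdges (wordSeg W r₃ m₄ hr₃L)).image (Sym2.map fun z => w + z) = wordArc W r₃ (r₃ + m₄) := by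
    rw [← hw, image_wordEdges_wordSeg W hr₃L]
  let t : Fin 8 → ℕ := ![0, r₁, M - (m₃ + m₄), r₂, r₂ + m₃, r₃, r₃ + m₄, L]
  refine mem_pi_disjointOccurrenceList_of_witnesses _ (c ∘ sqLabT3) (sqPiecesT3_upper _ r₁ _ _ x y w)
    (fun j => (↑(wordArc W (t j.castSucc) (t j.succ)) : Set (Sym2 (Site d)))) ?_ ?_
    (pairwise_disjoint_wordArc_cuts hW t ?_ le_rfl)
  · intro j
    fin_cases j
    · exact h0
    · show (↑(wordArc W r₁ (M - (m₃ + m₄))) : Set (Sym2 (Site d))) ⊆ ω (c 1)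
      exact (Finset.coe_subset.2 (wordArc_sub W le_rfl hMr₂)).trans h1
    · show (↑(wordArc W (M - (m₃ + m₄)) r₂) : Set (Sym2 (Site d))) ⊆ ω (c 1)
      exact (Finset.coe_subset.2 (wordArc_sub W hr₁M le_rfl)).trans h1
    · show (↑(wordArc W r₂ (r₂ + m₃)) : Set (Sym2 (Site d))) ⊆ ω (c 2)
      exact (Finset.coe_subset.2 (wordArc_sub W le_rfl hr₂₃)).trans h2
    · show (↑(wordArc W (r₂ + m₃) r₃) : Set (Sym2 (Site d))) ⊆ ω (c 2)
      exact (Finset.coe_subset.2 (wordArc_sub W (Nat.le_add_right _ _) le_rfl)).trans h2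
    · show (↑(wordArc W r₃ (r₃ + m₄)) : Set (Sym2 (Site d))) ⊆ ω (c 3)
      exact (Finset.coe_subset.2 (wordArc_sub W le_rfl hr₃L)).trans h3
    · show (↑(wordArc W (r₃ + m₄) L) : Set (Sym2 (Site d))) ⊆ ω (c 3)
      exact (Finset.coe_subset.2 (wordArc_sub W (Nat.le_add_right _ _) le_rfl)).trans h3
  · intro j
    fin_cases j
    · show (↑(wordArc W 0 r₁) : Set (Sym2 (Site d))) ∈ bondsOpen (wordArc (wordTake W (M - (m₃ + m₄)) hML) 0 r₁)
      rw [mem_bondsOpen, wordArc_wordTake W hML hr₁M]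
    · show (↑(wordArc W r₁ (M - (m₃ + m₄))) : Set (Sym2 (Site d))) ∈
        bondsOpen (wordArc (wordTake W (M - (m₃ + m₄)) hML) r₁ (M - (m₃ + m₄)))
      rw [mem_bondsOpen, wordArc_wordTake W hML le_rfl]
    · show (↑(wordArc W (M - (m₃ + m₄)) r₂) : Set (Sym2 (Site d))) ∈
        openConn (wordPos (wordTake W (M - (m₃ + m₄)) hML) (M - (m₃ + m₄))) y
      rw [hp₁, ← hy]
      exact wordArc_mem_openConn W hMr₂ (by omega)
    · show (↑(wordArc W r₂ (r₂ + m₃)) : Set (Sym2 (Site d))) ∈ wordOpenAt y (wordSeg W r₂ m₃ hr₂L)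
      rw [mem_wordOpenAt, hW₃]
    · show (↑(wordArc W (r₂ + m₃) r₃) : Set (Sym2 (Site d))) ∈ openConn (y + wordPos (wordSeg W r₂ m₃ hr₂L) m₃) w
      rw [hp₃, ← hw]
      exact wordArc_mem_openConn W hr₂₃ (by omega)
    · show (↑(wordArc W r₃ (r₃ + m₄)) : Set (Sym2 (Site d))) ∈ wordOpenAt w (wordSeg W r₃ m₄ hr₃L)
      rw [mem_wordOpenAt, hW₄]
    · show (↑(wordArc W (r₃ + m₄) L) : Set (Sym2 (Site d))) ∈ openConn (w + wordPos (wordSeg W r₃ m₄ hr₃L) m₄) x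
      rw [hp₄, ← hx]
      exact wordArc_mem_openConn W hr₃L le_rfl
  · intro i
    fin_cases i
    · show 0 ≤ r₁
      exact Nat.zero_le _
    · show r₁ ≤ M - (m₃ + m₄)
      exact hr₁M
    · show M - (m₃ + m₄) ≤ r₂
      exact hMr₂
    · show r₂ ≤ r₂ + m₃
      exact Nat.le_add_right _ _
    · show r₂ + m₃ ≤ r₃
      exact hr₂₃
    · show r₃ ≤ r₃ + m₄
      exact Nat.le_add_right _ _
    · show r₃ + m₄ ≤ L
      exact hr₃L

/-- **Four-tail piece**: `M − m₂ − m₃ − m₄ ≤ r₁`, `r₁ + m₂ ≤ r₂`, `r₂ + m₃ ≤ r₃`, `r₃ + m₄ ≤ L` (eight arcs of `W`, two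
per line). [cite: FitznerVanDerHofstad2016NoBLE, §5.3.2 (5.42) PTRF p. 1098] -/
theorem mem_sqBoxT4_of_trail {ω : Fin k → BondConfig (Site d)} {L M m₂ m₃ m₄ r₁ r₂ r₃ : ℕ} {v y w x : Site d}
    {W : Fin L → Fin d × Bool} (hW : IsTrail W) (hMr₁ : M - (m₂ + m₃ + m₄) ≤ r₁) (hr₁₂ : r₁ + m₂ ≤ r₂)
    (hr₂₃ : r₂ + m₃ ≤ r₃) (hr₃L : r₃ + m₄ ≤ L) (hML : M - (m₂ + m₃ + m₄) ≤ L) (hr₁L : r₁ + m₂ ≤ L)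
    (hr₂L : r₂ + m₃ ≤ L) (hv : wordPos W r₁ = v) (hy : wordPos W r₂ = y) (hw : wordPos W r₃ = w)
    (hx : wordPos W L = x)
    (h0 : (↑(wordArc W 0 r₁) : Set (Sym2 (Site d))) ⊆ ω (c 0))
    (h1 : (↑(wordArc W r₁ r₂) : Set (Sym2 (Site d))) ⊆ ω (c 1))
    (h2 : (↑(wordArc W r₂ r₃) : Set (Sym2 (Site d))) ⊆ ω (c 2))
    (h3 : (↑(wordArc W r₃ L) : Set (Sym2 (Site d))) ⊆ ω (c 3)) :
    ω ∈ boxOf₄ (sqPiecesT4 (wordTake W (M - (m₂ + m₃ + m₄)) hML) (wordSeg W r₁ m₂ hr₁L) (wordSeg W r₂ m₃ hr₂L)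
      (wordSeg W r₃ m₄ hr₃L) x v y w) sqLabT4 c := by
  have hp₁ : wordPos (wordTake W (M - (m₂ + m₃ + m₄)) hML) (M - (m₂ + m₃ + m₄)) = wordPos W (M - (m₂ + m₃ + m₄)) :=
    wordPos_wordTake W hML le_rfl
  have hp₂ : v + wordPos (wordSeg W r₁ m₂ hr₁L) m₂ = wordPos W (r₁ + m₂) := by
    rw [← hv, wordPos_wordSeg W hr₁L le_rfl]
  have hp₃ : y + wordPos (wordSeg W r₂ m₃ hr₂L) m₃ = wordPos W (r₂ + m₃) := by
    rw [← hy, wordPos_wordSeg W hr₂L le_rfl]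
  have hp₄ : w + wordPos (wordSeg W r₃ m₄ hr₃L) m₄ = wordPos W (r₃ + m₄) := by
    rw [← hw, wordPos_wordSeg W hr₃L le_rfl]
  have hW₁ : wordEdges (wordTake W (M - (m₂ + m₃ + m₄)) hML) = wordArc W 0 (M - (m₂ + m₃ + m₄)) :=
    wordEdges_wordTake W hML
  have hW₂ : (wordEdges (wordSeg W r₁ m₂ hr₁L)).image (Sym2.map fun z => v + z) = wordArc W r₁ (r₁ + m₂) := by
    rw [← hv, image_wordEdges_wordSeg W hr₁L]
  have hW₃ : (wordEdges (wordSeg W r₂ m₃ hr₂L)).image (Sym2.map fun z => y + z) = wordArc W r₂ (r₂ + m₃) := by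
    rw [← hy, image_wordEdges_wordSeg W hr₂L]
  have hW₄ : (wordEdges (wordSeg W r₃ m₄ hr₃L)).image (Sym2.map fun z => w + z) = wordArc W r₃ (r₃ + m₄) := by
    rw [← hw, image_wordEdges_wordSeg W hr₃L]
  let t : Fin 9 → ℕ := ![0, M - (m₂ + m₃ + m₄), r₁, r₁ + m₂, r₂, r₂ + m₃, r₃, r₃ + m₄, L]
  refine mem_pi_disjointOccurrenceList_of_witnesses _ (c ∘ sqLabT4) (sqPiecesT4_upper _ _ _ _ x v y w)
    (fun j => (↑(wordArc W (t j.castSucc) (t j.succ)) : Set (Sym2 (Site d)))) ?_ ?_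
    (pairwise_disjoint_wordArc_cuts hW t ?_ le_rfl)
  · intro j
    fin_cases j
    · show (↑(wordArc W 0 (M - (m₂ + m₃ + m₄))) : Set (Sym2 (Site d))) ⊆ ω (c 0)
      exact (Finset.coe_subset.2 (wordArc_sub W le_rfl hMr₁)).trans h0
    · show (↑(wordArc W (M - (m₂ + m₃ + m₄)) r₁) : Set (Sym2 (Site d))) ⊆ ω (c 0)
      exact (Finset.coe_subset.2 (wordArc_sub W (Nat.zero_le _) le_rfl)).trans h0
    · show (↑(wordArc W r₁ (r₁ + m₂)) : Set (Sym2 (Site d))) ⊆ ω (c 1)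
      exact (Finset.coe_subset.2 (wordArc_sub W le_rfl hr₁₂)).trans h1
    · show (↑(wordArc W (r₁ + m₂) r₂) : Set (Sym2 (Site d))) ⊆ ω (c 1)
      exact (Finset.coe_subset.2 (wordArc_sub W (Nat.le_add_right _ _) le_rfl)).trans h1
    · show (↑(wordArc W r₂ (r₂ + m₃)) : Set (Sym2 (Site d))) ⊆ ω (c 2)
      exact (Finset.coe_subset.2 (wordArc_sub W le_rfl hr₂₃)).trans h2
    · show (↑(wordArc W (r₂ + m₃) r₃) : Set (Sym2 (Site d))) ⊆ ω (c 2)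
      exact (Finset.coe_subset.2 (wordArc_sub W (Nat.le_add_right _ _) le_rfl)).trans h2
    · show (↑(wordArc W r₃ (r₃ + m₄)) : Set (Sym2 (Site d))) ⊆ ω (c 3)
      exact (Finset.coe_subset.2 (wordArc_sub W le_rfl hr₃L)).trans h3
    · show (↑(wordArc W (r₃ + m₄) L) : Set (Sym2 (Site d))) ⊆ ω (c 3)
      exact (Finset.coe_subset.2 (wordArc_sub W (Nat.le_add_right _ _) le_rfl)).trans h3
  · intro j
    fin_cases j
    · show (↑(wordArc W 0 (M - (m₂ + m₃ + m₄))) : Set (Sym2 (Site d))) ∈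
        wordOpen (wordTake W (M - (m₂ + m₃ + m₄)) hML)
      rw [mem_wordOpen, hW₁]
    · show (↑(wordArc W (M - (m₂ + m₃ + m₄)) r₁) : Set (Sym2 (Site d))) ∈
        openConn (wordPos (wordTake W (M - (m₂ + m₃ + m₄)) hML) (M - (m₂ + m₃ + m₄))) v
      rw [hp₁, ← hv]
      exact wordArc_mem_openConn W hMr₁ (by omega)
    · show (↑(wordArc W r₁ (r₁ + m₂)) : Set (Sym2 (Site d))) ∈ wordOpenAt v (wordSeg W r₁ m₂ hr₁L)
      rw [mem_wordOpenAt, hW₂]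
    · show (↑(wordArc W (r₁ + m₂) r₂) : Set (Sym2 (Site d))) ∈ openConn (v + wordPos (wordSeg W r₁ m₂ hr₁L) m₂) y
      rw [hp₂, ← hy]
      exact wordArc_mem_openConn W hr₁₂ (by omega)
    · show (↑(wordArc W r₂ (r₂ + m₃)) : Set (Sym2 (Site d))) ∈ wordOpenAt y (wordSeg W r₂ m₃ hr₂L)
      rw [mem_wordOpenAt, hW₃]
    · show (↑(wordArc W (r₂ + m₃) r₃) : Set (Sym2 (Site d))) ∈ openConn (y + wordPos (wordSeg W r₂ m₃ hr₂L) m₃) w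
      rw [hp₃, ← hw]
      exact wordArc_mem_openConn W hr₂₃ (by omega)
    · show (↑(wordArc W r₃ (r₃ + m₄)) : Set (Sym2 (Site d))) ∈ wordOpenAt w (wordSeg W r₃ m₄ hr₃L)
      rw [mem_wordOpenAt, hW₄]
    · show (↑(wordArc W (r₃ + m₄) L) : Set (Sym2 (Site d))) ∈ openConn (w + wordPos (wordSeg W r₃ m₄ hr₃L) m₄) x
      rw [hp₄, ← hx]
      exact wordArc_mem_openConn W hr₃L le_rfl
  · intro i
    fin_cases i
    · show 0 ≤ M - (m₂ + m₃ + m₄)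
      exact Nat.zero_le _
    · show M - (m₂ + m₃ + m₄) ≤ r₁
      exact hMr₁
    · show r₁ ≤ r₁ + m₂
      exact Nat.le_add_right _ _
    · show r₁ + m₂ ≤ r₂
      exact hr₁₂
    · show r₂ ≤ r₂ + m₃
      exact Nat.le_add_right _ _
    · show r₂ + m₃ ≤ r₃
      exact hr₂₃
    · show r₃ ≤ r₃ + m₄
      exact Nat.le_add_right _ _
    · show r₃ + m₄ ≤ L
      exact hr₃L

/-- **Extraction on `k` configurations** (five cases, as `mem_sqEvent_of_trail`).
[cite: FitznerVanDerHofstad2016NoBLE, §5.3.2 (5.42) PTRF p. 1098]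
[cite: FitznerVanDerHofstad2017, §4.2 (4.17)–(4.18) and the display after (4.18) (arXiv:1506.07977v2 p. 36 = EJP p. 33)] -/
theorem mem_sqEventL_of_trail (m₁ m₂ m₃ m₄ M : ℕ) {ω : Fin k → BondConfig (Site d)} {L r₁ r₂ r₃ : ℕ}
    {v y w x : Site d} {W : Fin L → Fin d × Bool} (hW : IsTrail W) (hr₁ : m₁ ≤ r₁) (hr₁₂ : r₁ + m₂ ≤ r₂)
    (hr₂₃ : r₂ + m₃ ≤ r₃) (hr₃L : r₃ + m₄ ≤ L) (hv : wordPos W r₁ = v) (hy : wordPos W r₂ = y)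
    (hw : wordPos W r₃ = w) (hx : wordPos W L = x)
    (h0 : (↑(wordArc W 0 r₁) : Set (Sym2 (Site d))) ⊆ ω (c 0))
    (h1 : (↑(wordArc W r₁ r₂) : Set (Sym2 (Site d))) ⊆ ω (c 1))
    (h2 : (↑(wordArc W r₂ r₃) : Set (Sym2 (Site d))) ⊆ ω (c 2))
    (h3 : (↑(wordArc W r₃ L) : Set (Sym2 (Site d))) ⊆ ω (c 3)) :
    ∃ i ∈ idxAllS m₁ m₂ m₃ m₄ M x v y w, ω ∈ sqEventL c m₂ m₃ m₄ M x v y w i := by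
  classical
  by_cases hLM : L < M
  · refine ⟨Sum.inl ⟨L, (W, r₁, r₂, r₃)⟩, ?_, mem_sqBoxE_of_trail c hW (by omega) (by omega) (by omega) h0 h1 h2 h3⟩
    simp only [idxAllS, Finset.inl_mem_disjSum, idxExplicitS, baseExplicitS, Finset.mem_filter, Finset.mem_sigma,
      Finset.mem_product, mem_trailWordsTo, Finset.mem_Ico, sqTriplesE, Finset.mem_Icc]
    exact ⟨⟨⟨⟨by omega, hLM⟩, ⟨hW, hx⟩, ⟨⟨by omega, by omega⟩, ⟨by omega, by omega⟩, by omega, by omega⟩,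
      hr₁₂, hr₂₃⟩, hv, hy⟩, hw⟩
  · replace hLM : M ≤ L := not_lt.1 hLM
    by_cases hr₃M : r₃ < M - m₄
    · refine ⟨Sum.inr (Sum.inl (wordTake W M hLM, r₁, r₂, r₃)), ?_,
        mem_sqBoxO_of_trail c hW hLM (by omega) (by omega) (by omega) hx h0 h1 h2 h3⟩
      simp only [idxAllS, Finset.inr_mem_disjSum, Finset.inl_mem_disjSum, idxOneTailS, baseOneTailS,
        Finset.mem_filter, Finset.mem_product, mem_trailWords, sqTriplesO, Finset.mem_Ico]
      exact ⟨⟨⟨hW.wordTake hLM, ⟨⟨hr₁, by omega⟩, ⟨by omega, by omega⟩, by omega, hr₃M⟩, hr₁₂, hr₂₃⟩,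
        by rw [wordPos_wordTake W hLM (by omega), hv], by rw [wordPos_wordTake W hLM (by omega), hy]⟩,
        by rw [wordPos_wordTake W hLM (by omega), hw]⟩
    · replace hr₃M : M - m₄ ≤ r₃ := not_lt.1 hr₃M
      by_cases hr₂M : r₂ < M - m₄ - m₃
      · have hMm : M - m₄ ≤ L := by omega
        refine ⟨Sum.inr (Sum.inr (Sum.inl ((wordTake W (M - m₄) hMm, r₁, r₂), wordSeg W r₃ m₄ hr₃L))), ?_,
          mem_sqBoxT2_of_trail c hW (by omega) (by omega) hr₃M hr₃L hMm hw hx h0 h1 h2 h3⟩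
        simp only [idxAllS, Finset.inr_mem_disjSum, Finset.inl_mem_disjSum, idxTwoTailS, baseTwoTailS,
          Finset.mem_filter, Finset.mem_product, mem_trailWords, triPairsO, Finset.mem_Ico]
        exact ⟨⟨⟨hW.wordTake hMm, ⟨⟨hr₁, by omega⟩, by omega, hr₂M⟩, hr₁₂⟩, hW.wordSeg hr₃L⟩,
          by rw [wordPos_wordTake W hMm (by omega), hv], by rw [wordPos_wordTake W hMm (by omega), hy]⟩
      · replace hr₂M : M - m₄ - m₃ ≤ r₂ := not_lt.1 hr₂M
        by_cases hr₁M : r₁ < M - (m₂ + m₃ + m₄)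
        · have hML : M - (m₃ + m₄) ≤ L := by omega
          have hr₂L : r₂ + m₃ ≤ L := by omega
          refine ⟨Sum.inr (Sum.inr (Sum.inr (Sum.inl ((wordTake W (M - (m₃ + m₄)) hML, r₁), wordSeg W r₂ m₃ hr₂L,
            wordSeg W r₃ m₄ hr₃L)))), ?_,
            mem_sqBoxT3_of_trail c hW (by omega) (by omega) hr₂₃ hr₃L hML hr₂L hy hw hx h0 h1 h2 h3⟩
          simp only [idxAllS, Finset.inr_mem_disjSum, Finset.inl_mem_disjSum, idxThreeTailS, baseThreeTailS,
            Finset.mem_filter, Finset.mem_product, mem_trailWords, Finset.mem_Ico]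
          exact ⟨⟨⟨hW.wordTake hML, hr₁, hr₁M⟩, hW.wordSeg hr₂L, hW.wordSeg hr₃L⟩,
            by rw [wordPos_wordTake W hML (by omega), hv]⟩
        · replace hr₁M : M - (m₂ + m₃ + m₄) ≤ r₁ := not_lt.1 hr₁M
          have hML : M - (m₂ + m₃ + m₄) ≤ L := by omega
          have hr₁L : r₁ + m₂ ≤ L := by omega
          have hr₂L : r₂ + m₃ ≤ L := by omega
          refine ⟨Sum.inr (Sum.inr (Sum.inr (Sum.inr (wordTake W (M - (m₂ + m₃ + m₄)) hML, wordSeg W r₁ m₂ hr₁L,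
            wordSeg W r₂ m₃ hr₂L, wordSeg W r₃ m₄ hr₃L)))), ?_,
            mem_sqBoxT4_of_trail c hW hr₁M hr₁₂ hr₂₃ hr₃L hML hr₁L hr₂L hv hy hw hx h0 h1 h2 h3⟩
          simp only [idxAllS, Finset.inr_mem_disjSum, idxFourTailS, Finset.mem_product, mem_trailWords]
          exact ⟨hW.wordTake hML, hW.wordSeg hr₁L, hW.wordSeg hr₂L, hW.wordSeg hr₃L⟩

end Extraction

/-! ### E. The measure of each box: independence across configurations × BK within -/

section MeasureBounds

variable {k : ℕ} (c : Fin 4 → Fin k) (p : unitInterval)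

/-- **Explicit box**: `ℙ_p^{⊗k}(box) ≤ p^{r₁} p^{r₂−r₁} p^{r₃−r₂} p^{L−r₃} = p^L`.
[cite: FitznerVanDerHofstad2016NoBLE, §5.3.2 (5.42) PTRF p. 1098] -/
theorem piReal_sqBoxE_le {L : ℕ} {W : Fin L → Fin d × Bool} (hW : IsTrail W) {r₁ r₂ r₃ : ℕ} (hr₁₂ : r₁ ≤ r₂)
    (hr₂₃ : r₂ ≤ r₃) (hr₃L : r₃ ≤ L) :
    (Measure.pi (fun _ : Fin k => bondPercolation (zdGraph d) p)).real (boxOf₄ (sqPiecesE W r₁ r₂ r₃) sqLabE c) ≤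
      (p : ℝ) ^ L := by
  classical
  have h := pi_real_pi_disjointOccurrenceList_le_prod (zdGraph d) p (sqPiecesE W r₁ r₂ r₃) (c ∘ sqLabE)
    (sqPiecesE_upper W r₁ r₂ r₃) (sqPiecesE_finitary W r₁ r₂ r₃)
  rw [Fin.prod_univ_four] at h
  simp only [sqPiecesE, Matrix.cons_val] at h
  rw [measureReal_bondsOpen_wordArc p hW (hr₁₂.trans (hr₂₃.trans hr₃L)),
    measureReal_bondsOpen_wordArc p hW (hr₂₃.trans hr₃L), measureReal_bondsOpen_wordArc p hW hr₃L,
    measureReal_bondsOpen_wordArc p hW le_rfl, ← pow_add, ← pow_add, ← pow_add,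
    show r₁ - 0 + (r₂ - r₁) + (r₃ - r₂) + (L - r₃) = L by omega] at h
  exact h

/-- **One-tail box**: `ℙ_p^{⊗k}(box) ≤ p^M τ_p(u(M), x)`. [cite: FitznerVanDerHofstad2016NoBLE, §5.3.2 (5.42) PTRF p. 1098] -/
theorem piReal_sqBoxO_le {M : ℕ} {u : Fin M → Fin d × Bool} (hu : IsTrail u) {r₁ r₂ r₃ : ℕ} (hr₁₂ : r₁ ≤ r₂)
    (hr₂₃ : r₂ ≤ r₃) (hr₃M : r₃ ≤ M) (x : Site d) :
    (Measure.pi (fun _ : Fin k => bondPercolation (zdGraph d) p)).real (boxOf₄ (sqPiecesO u r₁ r₂ r₃ x) sqLabO c) ≤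
      (p : ℝ) ^ M * tau d p (wordPos u M) x := by
  classical
  have h := pi_real_pi_disjointOccurrenceList_le_prod (zdGraph d) p (sqPiecesO u r₁ r₂ r₃ x) (c ∘ sqLabO)
    (sqPiecesO_upper u r₁ r₂ r₃ x) (sqPiecesO_finitary u r₁ r₂ r₃ x)
  rw [Fin.prod_univ_five] at h
  simp only [sqPiecesO, Matrix.cons_val] at h
  rw [measureReal_bondsOpen_wordArc p hu (hr₁₂.trans (hr₂₃.trans hr₃M)),
    measureReal_bondsOpen_wordArc p hu (hr₂₃.trans hr₃M), measureReal_bondsOpen_wordArc p hu hr₃M,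
    measureReal_bondsOpen_wordArc p hu le_rfl, ← tau_def, ← pow_add, ← pow_add, ← pow_add,
    show r₁ - 0 + (r₂ - r₁) + (r₃ - r₂) + (M - r₃) = M by omega] at h
  exact h

/-- **Two-tail box**: `ℙ_p^{⊗k}(box) ≤ p^{M−m₄} p^{m₄} τ_p(u₁(M−m₄), w) τ_p(w + u₄(m₄), x)`.
[cite: FitznerVanDerHofstad2016NoBLE, §5.3.2 (5.42) PTRF p. 1098] -/
theorem piReal_sqBoxT2_le {M m₄ : ℕ} {u₁ : Fin (M - m₄) → Fin d × Bool} (hu₁ : IsTrail u₁)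
    {u₄ : Fin m₄ → Fin d × Bool} (hu₄ : IsTrail u₄) {r₁ r₂ : ℕ} (hr₁₂ : r₁ ≤ r₂) (hr₂M : r₂ ≤ M - m₄)
    (x w : Site d) :
    (Measure.pi (fun _ : Fin k => bondPercolation (zdGraph d) p)).real
        (boxOf₄ (sqPiecesT2 u₁ r₁ r₂ u₄ x w) sqLabT2 c) ≤
      (p : ℝ) ^ (M - m₄) * (p : ℝ) ^ m₄ * (tau d p (wordPos u₁ (M - m₄)) w * tau d p (w + wordPos u₄ m₄) x) := by
  classical
  have h := pi_real_pi_disjointOccurrenceList_le_prod (zdGraph d) p (sqPiecesT2 u₁ r₁ r₂ u₄ x w) (c ∘ sqLabT2)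
    (sqPiecesT2_upper u₁ r₁ r₂ u₄ x w) (sqPiecesT2_finitary u₁ r₁ r₂ u₄ x w)
  rw [Fin.prod_univ_six] at h
  simp only [sqPiecesT2, Matrix.cons_val] at h
  rw [measureReal_bondsOpen_wordArc p hu₁ (hr₁₂.trans hr₂M), measureReal_bondsOpen_wordArc p hu₁ hr₂M,
    measureReal_bondsOpen_wordArc p hu₁ le_rfl, measureReal_wordOpenAt_of_isTrail p w hu₄, ← tau_def,
    ← tau_def] at h
  have hpow : (p : ℝ) ^ (r₁ - 0) * (p : ℝ) ^ (r₂ - r₁) * (p : ℝ) ^ (M - m₄ - r₂) = (p : ℝ) ^ (M - m₄) := by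
    rw [← pow_add, ← pow_add, show r₁ - 0 + (r₂ - r₁) + (M - m₄ - r₂) = M - m₄ by omega]
  calc _ ≤ _ := h
    _ = (p : ℝ) ^ (r₁ - 0) * (p : ℝ) ^ (r₂ - r₁) * (p : ℝ) ^ (M - m₄ - r₂) * (p : ℝ) ^ m₄ *
          (tau d p (wordPos u₁ (M - m₄)) w * tau d p (w + wordPos u₄ m₄) x) := by ring
    _ = _ := by rw [hpow]

/-- **Three-tail box**: `ℙ_p^{⊗k}(box) ≤ p^{M−m₃−m₄} p^{m₃} p^{m₄} τ τ τ`.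
[cite: FitznerVanDerHofstad2016NoBLE, §5.3.2 (5.42) PTRF p. 1098] -/
theorem piReal_sqBoxT3_le {M m₃ m₄ : ℕ} {u₁ : Fin (M - (m₃ + m₄)) → Fin d × Bool} (hu₁ : IsTrail u₁)
    {u₃ : Fin m₃ → Fin d × Bool} (hu₃ : IsTrail u₃) {u₄ : Fin m₄ → Fin d × Bool} (hu₄ : IsTrail u₄) {r₁ : ℕ}
    (hr₁ : r₁ ≤ M - (m₃ + m₄)) (x y w : Site d) :
    (Measure.pi (fun _ : Fin k => bondPercolation (zdGraph d) p)).real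
        (boxOf₄ (sqPiecesT3 u₁ r₁ u₃ u₄ x y w) sqLabT3 c) ≤
      (p : ℝ) ^ (M - (m₃ + m₄)) * (p : ℝ) ^ m₃ * (p : ℝ) ^ m₄ *
        (tau d p (wordPos u₁ (M - (m₃ + m₄))) y * tau d p (y + wordPos u₃ m₃) w *
          tau d p (w + wordPos u₄ m₄) x) := by
  classical
  have h := pi_real_pi_disjointOccurrenceList_le_prod (zdGraph d) p (sqPiecesT3 u₁ r₁ u₃ u₄ x y w) (c ∘ sqLabT3)
    (sqPiecesT3_upper u₁ r₁ u₃ u₄ x y w) (sqPiecesT3_finitary u₁ r₁ u₃ u₄ x y w)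
  rw [Fin.prod_univ_seven] at h
  simp only [sqPiecesT3, Matrix.cons_val] at h
  rw [measureReal_bondsOpen_wordArc p hu₁ hr₁, measureReal_bondsOpen_wordArc p hu₁ le_rfl,
    measureReal_wordOpenAt_of_isTrail p y hu₃, measureReal_wordOpenAt_of_isTrail p w hu₄, ← tau_def, ← tau_def,
    ← tau_def] at h
  have hpow : (p : ℝ) ^ (r₁ - 0) * (p : ℝ) ^ (M - (m₃ + m₄) - r₁) = (p : ℝ) ^ (M - (m₃ + m₄)) := by
    rw [← pow_add, show r₁ - 0 + (M - (m₃ + m₄) - r₁) = M - (m₃ + m₄) by omega]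
  calc _ ≤ _ := h
    _ = (p : ℝ) ^ (r₁ - 0) * (p : ℝ) ^ (M - (m₃ + m₄) - r₁) * (p : ℝ) ^ m₃ * (p : ℝ) ^ m₄ *
          (tau d p (wordPos u₁ (M - (m₃ + m₄))) y * tau d p (y + wordPos u₃ m₃) w *
            tau d p (w + wordPos u₄ m₄) x) := by ring
    _ = _ := by rw [hpow]

/-- **Four-tail box**: `ℙ_p^{⊗k}(box) ≤ p^{M−m₂−m₃−m₄} p^{m₂} p^{m₃} p^{m₄} τ τ τ τ`.
[cite: FitznerVanDerHofstad2016NoBLE, §5.3.2 (5.42) PTRF p. 1098] -/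
theorem piReal_sqBoxT4_le {M m₂ m₃ m₄ : ℕ} {u₁ : Fin (M - (m₂ + m₃ + m₄)) → Fin d × Bool} (hu₁ : IsTrail u₁)
    {u₂ : Fin m₂ → Fin d × Bool} (hu₂ : IsTrail u₂) {u₃ : Fin m₃ → Fin d × Bool} (hu₃ : IsTrail u₃)
    {u₄ : Fin m₄ → Fin d × Bool} (hu₄ : IsTrail u₄) (x v y w : Site d) :
    (Measure.pi (fun _ : Fin k => bondPercolation (zdGraph d) p)).real
        (boxOf₄ (sqPiecesT4 u₁ u₂ u₃ u₄ x v y w) sqLabT4 c) ≤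
      (p : ℝ) ^ (M - (m₂ + m₃ + m₄)) * (p : ℝ) ^ m₂ * (p : ℝ) ^ m₃ * (p : ℝ) ^ m₄ *
        (tau d p (wordPos u₁ (M - (m₂ + m₃ + m₄))) v * tau d p (v + wordPos u₂ m₂) y *
          tau d p (y + wordPos u₃ m₃) w * tau d p (w + wordPos u₄ m₄) x) := by
  classical
  have h := pi_real_pi_disjointOccurrenceList_le_prod (zdGraph d) p (sqPiecesT4 u₁ u₂ u₃ u₄ x v y w) (c ∘ sqLabT4)
    (sqPiecesT4_upper u₁ u₂ u₃ u₄ x v y w) (sqPiecesT4_finitary u₁ u₂ u₃ u₄ x v y w)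
  rw [Fin.prod_univ_eight] at h
  simp only [sqPiecesT4, Matrix.cons_val] at h
  rw [measureReal_wordOpen_of_isTrail p hu₁, measureReal_wordOpenAt_of_isTrail p v hu₂,
    measureReal_wordOpenAt_of_isTrail p y hu₃, measureReal_wordOpenAt_of_isTrail p w hu₄, ← tau_def, ← tau_def,
    ← tau_def, ← tau_def] at h
  calc _ ≤ _ := h
    _ = _ := by ring

end MeasureBounds

/-! ### F. The pointwise bound (every configuration assignment) -/

/-- **The square member `c`, pointwise in `(v, y, w)`, by extraction** — the same right-hand side as
`diagS_le_extraction` (every `k, c, m₁, …, m₄, M, x, v, y, w, p`).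
[cite: FitznerVanDerHofstad2016NoBLE, §5.3.2 (5.42) PTRF p. 1098]
[cite: FitznerVanDerHofstad2017, §4.2 (4.17)–(4.18) and the display after (4.18) (arXiv:1506.07977v2 p. 36 = EJP p. 33)] -/
theorem diagSL_le_extraction {k : ℕ} (c : Fin 4 → Fin k) (p : unitInterval) (m₁ m₂ m₃ m₄ M : ℕ)
    (x v y w : Site d) :
    diagSL d k p c m₁ m₂ m₃ m₄ v y w x ≤
      (∑ t ∈ idxExplicitS m₁ m₂ m₃ m₄ M x v y w, (p : ℝ) ^ t.1) +
        (∑ t ∈ idxOneTailS (d := d) m₁ m₂ m₃ m₄ M v y w, (p : ℝ) ^ M * tau d p (wordPos t.1 M) x) +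
          (∑ t ∈ idxTwoTailS (d := d) m₁ m₂ m₃ m₄ M v y,
            (p : ℝ) ^ (M - m₄) * (p : ℝ) ^ m₄ *
              (tau d p (wordPos t.1.1 (M - m₄)) w * tau d p (w + wordPos t.2 m₄) x)) +
            (∑ t ∈ idxThreeTailS (d := d) m₁ m₂ m₃ m₄ M v,
              (p : ℝ) ^ (M - (m₃ + m₄)) * (p : ℝ) ^ m₃ * (p : ℝ) ^ m₄ *
                (tau d p (wordPos t.1.1 (M - (m₃ + m₄))) y * tau d p (y + wordPos t.2.1 m₃) w *
                  tau d p (w + wordPos t.2.2 m₄) x)) +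
              ∑ t ∈ idxFourTailS (d := d) m₂ m₃ m₄ M,
                (p : ℝ) ^ (M - (m₂ + m₃ + m₄)) * (p : ℝ) ^ m₂ * (p : ℝ) ^ m₃ * (p : ℝ) ^ m₄ *
                  (tau d p (wordPos t.1 (M - (m₂ + m₃ + m₄))) v * tau d p (v + wordPos t.2.1 m₂) y *
                    tau d p (y + wordPos t.2.2.1 m₃) w * tau d p (w + wordPos t.2.2.2 m₄) x) := by
  classical
  set μ := bondPercolation (zdGraph d) p with hμ
  set ν : Measure (Fin k → BondConfig (Site d)) := Measure.pi (fun _ : Fin k => μ) with hν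
  set T : Set (Fin k → BondConfig (Site d)) := genDisjConnN (sqLines c m₁ m₂ m₃ m₄ v y w x) with hT
  set bad : Set (Fin k → BondConfig (Site d)) :=
    ⋃ j : Fin k, Function.eval j ⁻¹' {ω | ¬ ω ⊆ (zdGraph d).edgeSet} with hbad
  have h0 : μ {ω | ¬ ω ⊆ (zdGraph d).edgeSet} = 0 := by
    have := ProbabilityTheory.setBernoulli_ae_subset (u := (zdGraph d).edgeSet) (p := p)
    rw [Filter.Eventually, mem_ae_iff, Set.compl_setOf] at this
    exact this
  have hbad0 : ν.real bad = 0 := by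
    rw [measureReal_def, measure_iUnion_null fun j => ?_, ENNReal.toReal_zero]
    exact Measure.pi_eval_preimage_null (fun _ : Fin k => μ) h0
  -- the covering
  have hcov : T ⊆ bad ∪ ⋃ i ∈ idxAllS m₁ m₂ m₃ m₄ M x v y w, sqEventL c m₂ m₃ m₄ M x v y w i := by
    intro ω hω
    by_cases hb : ∀ j, ω j ⊆ (zdGraph d).edgeSet
    · right
      obtain ⟨L, r₁, r₂, r₃, W, hW, hr₁, hr₁₂, hr₂₃, hr₃L, hv, hy, hw, hx, hW0, hW1, hW2, hW3⟩ :=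
        exists_trail_of_mem_genDisjConnN_sqLines hb hω
      obtain ⟨i, hi, hωi⟩ :=
        mem_sqEventL_of_trail c m₁ m₂ m₃ m₄ M hW hr₁ hr₁₂ hr₂₃ hr₃L hv hy hw hx hW0 hW1 hW2 hW3
      exact Set.mem_biUnion (Finset.mem_coe.2 hi) hωi
    · left
      obtain ⟨j, hj⟩ := not_forall.1 hb
      exact Set.mem_iUnion.2 ⟨j, hj⟩
  have h1 : diagSL d k p c m₁ m₂ m₃ m₄ v y w x ≤
      ∑ i ∈ idxAllS m₁ m₂ m₃ m₄ M x v y w, ν.real (sqEventL c m₂ m₃ m₄ M x v y w i) := by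
    calc diagSL d k p c m₁ m₂ m₃ m₄ v y w x = ν.real T := rfl
      _ ≤ ν.real (bad ∪ ⋃ i ∈ idxAllS m₁ m₂ m₃ m₄ M x v y w, sqEventL c m₂ m₃ m₄ M x v y w i) :=
          measureReal_mono hcov
      _ ≤ ν.real bad + ν.real (⋃ i ∈ idxAllS m₁ m₂ m₃ m₄ M x v y w, sqEventL c m₂ m₃ m₄ M x v y w i) :=
          measureReal_union_le _ _
      _ ≤ 0 + ∑ i ∈ idxAllS m₁ m₂ m₃ m₄ M x v y w, ν.real (sqEventL c m₂ m₃ m₄ M x v y w i) :=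
          add_le_add hbad0.le (measureReal_biUnion_finset_le _ _)
      _ = _ := zero_add _
  -- split into the five families and bound each box
  rw [idxAllS, Finset.sum_disjSum, Finset.sum_disjSum, Finset.sum_disjSum, Finset.sum_disjSum] at h1
  have hE : ∑ t ∈ idxExplicitS m₁ m₂ m₃ m₄ M x v y w, ν.real (sqEventL c m₂ m₃ m₄ M x v y w (Sum.inl t)) ≤
      ∑ t ∈ idxExplicitS m₁ m₂ m₃ m₄ M x v y w, (p : ℝ) ^ t.1 := by
    refine Finset.sum_le_sum fun t ht => ?_
    obtain ⟨L, W, r₁, r₂, r₃⟩ := t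
    simp only [idxExplicitS, baseExplicitS, sqTriplesE, Finset.mem_filter, Finset.mem_sigma, Finset.mem_product,
      mem_trailWordsTo, Finset.mem_Icc, Finset.mem_Ico] at ht
    exact piReal_sqBoxE_le c p ht.1.1.2.1.1 (by omega) (by omega) (by omega)
  have hO : ∑ t ∈ idxOneTailS (d := d) m₁ m₂ m₃ m₄ M v y w,
      ν.real (sqEventL c m₂ m₃ m₄ M x v y w (Sum.inr (Sum.inl t))) ≤
      ∑ t ∈ idxOneTailS (d := d) m₁ m₂ m₃ m₄ M v y w, (p : ℝ) ^ M * tau d p (wordPos t.1 M) x := by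
    refine Finset.sum_le_sum fun t ht => ?_
    obtain ⟨u, r₁, r₂, r₃⟩ := t
    simp only [idxOneTailS, baseOneTailS, sqTriplesO, Finset.mem_filter, Finset.mem_product, mem_trailWords,
      Finset.mem_Ico] at ht
    exact piReal_sqBoxO_le c p ht.1.1.1 (by omega) (by omega) (by omega) x
  have hT2 : ∑ t ∈ idxTwoTailS (d := d) m₁ m₂ m₃ m₄ M v y,
      ν.real (sqEventL c m₂ m₃ m₄ M x v y w (Sum.inr (Sum.inr (Sum.inl t)))) ≤
      ∑ t ∈ idxTwoTailS (d := d) m₁ m₂ m₃ m₄ M v y, (p : ℝ) ^ (M - m₄) * (p : ℝ) ^ m₄ *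
        (tau d p (wordPos t.1.1 (M - m₄)) w * tau d p (w + wordPos t.2 m₄) x) := by
    refine Finset.sum_le_sum fun t ht => ?_
    obtain ⟨⟨u₁, r₁, r₂⟩, u₄⟩ := t
    simp only [idxTwoTailS, baseTwoTailS, triPairsO, Finset.mem_filter, Finset.mem_product, mem_trailWords,
      Finset.mem_Ico] at ht
    exact piReal_sqBoxT2_le c p ht.1.1.1 ht.1.2 (by omega) (by omega) x w
  have hT3 : ∑ t ∈ idxThreeTailS (d := d) m₁ m₂ m₃ m₄ M v,
      ν.real (sqEventL c m₂ m₃ m₄ M x v y w (Sum.inr (Sum.inr (Sum.inr (Sum.inl t))))) ≤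
      ∑ t ∈ idxThreeTailS (d := d) m₁ m₂ m₃ m₄ M v, (p : ℝ) ^ (M - (m₃ + m₄)) * (p : ℝ) ^ m₃ * (p : ℝ) ^ m₄ *
        (tau d p (wordPos t.1.1 (M - (m₃ + m₄))) y * tau d p (y + wordPos t.2.1 m₃) w *
          tau d p (w + wordPos t.2.2 m₄) x) := by
    refine Finset.sum_le_sum fun t ht => ?_
    obtain ⟨⟨u₁, r₁⟩, u₃, u₄⟩ := t
    simp only [idxThreeTailS, baseThreeTailS, Finset.mem_filter, Finset.mem_product, mem_trailWords,
      Finset.mem_Ico] at ht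
    exact piReal_sqBoxT3_le c p ht.1.1.1 ht.1.2.1 ht.1.2.2 (by omega) x y w
  have hT4 : ∑ t ∈ idxFourTailS (d := d) m₂ m₃ m₄ M,
      ν.real (sqEventL c m₂ m₃ m₄ M x v y w (Sum.inr (Sum.inr (Sum.inr (Sum.inr t))))) ≤
      ∑ t ∈ idxFourTailS (d := d) m₂ m₃ m₄ M,
        (p : ℝ) ^ (M - (m₂ + m₃ + m₄)) * (p : ℝ) ^ m₂ * (p : ℝ) ^ m₃ * (p : ℝ) ^ m₄ *
          (tau d p (wordPos t.1 (M - (m₂ + m₃ + m₄))) v * tau d p (v + wordPos t.2.1 m₂) y *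
            tau d p (y + wordPos t.2.2.1 m₃) w * tau d p (w + wordPos t.2.2.2 m₄) x) := by
    refine Finset.sum_le_sum fun t ht => ?_
    obtain ⟨u₁, u₂, u₃, u₄⟩ := t
    simp only [idxFourTailS, Finset.mem_product, mem_trailWords] at ht
    exact piReal_sqBoxT4_le c p ht.1 ht.2.1 ht.2.2.1 ht.2.2.2 x v y w
  linarith

/-- **The repulsive square (maximum over the assignments `(1,i,j,l)`) pointwise by extraction.**
[cite: FitznerVanDerHofstad2017, §4.2 (4.17) and the sentence after it (arXiv:1506.07977v2 p. 36 = EJP p. 33)]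
[cite: FitznerVanDerHofstad2016NoBLE, §5.3.2 (5.42) PTRF p. 1098] -/
theorem repSquare_le_extraction (p : unitInterval) (m₁ m₂ m₃ m₄ M : ℕ) (x v y w : Site d) :
    repSquare d p m₁ m₂ m₃ m₄ v y w x ≤
      (∑ t ∈ idxExplicitS m₁ m₂ m₃ m₄ M x v y w, (p : ℝ) ^ t.1) +
        (∑ t ∈ idxOneTailS (d := d) m₁ m₂ m₃ m₄ M v y w, (p : ℝ) ^ M * tau d p (wordPos t.1 M) x) +
          (∑ t ∈ idxTwoTailS (d := d) m₁ m₂ m₃ m₄ M v y,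
            (p : ℝ) ^ (M - m₄) * (p : ℝ) ^ m₄ *
              (tau d p (wordPos t.1.1 (M - m₄)) w * tau d p (w + wordPos t.2 m₄) x)) +
            (∑ t ∈ idxThreeTailS (d := d) m₁ m₂ m₃ m₄ M v,
              (p : ℝ) ^ (M - (m₃ + m₄)) * (p : ℝ) ^ m₃ * (p : ℝ) ^ m₄ *
                (tau d p (wordPos t.1.1 (M - (m₃ + m₄))) y * tau d p (y + wordPos t.2.1 m₃) w *
                  tau d p (w + wordPos t.2.2 m₄) x)) +
              ∑ t ∈ idxFourTailS (d := d) m₂ m₃ m₄ M,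
                (p : ℝ) ^ (M - (m₂ + m₃ + m₄)) * (p : ℝ) ^ m₂ * (p : ℝ) ^ m₃ * (p : ℝ) ^ m₄ *
                  (tau d p (wordPos t.1 (M - (m₂ + m₃ + m₄))) v * tau d p (v + wordPos t.2.1 m₂) y *
                    tau d p (y + wordPos t.2.2.1 m₃) w * tau d p (w + wordPos t.2.2.2 m₄) x) :=
  Finset.sup'_le _ _ fun ijl _ => diagSL_le_extraction (![0, ijl.1, ijl.2.1, ijl.2.2]) p m₁ m₂ m₃ m₄ M x v y w

/-! ### G. Summation over `(v, y, w)`: stated once for any pointwise-dominated `D` -/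

/-- **[NoBLE17] (5.42) summed over finite sets `v ∈ S₁`, `y ∈ S₂`, `w ∈ S₃`, for ANY `D(v,y,w)` obeying the pointwise
extraction bound** (the bookkeeping of `sum3_diagS_le_extraction`, abstracted from `diagS`).
[cite: FitznerVanDerHofstad2016NoBLE, §5.3.2 (5.42) PTRF p. 1098] -/
theorem sum3_le_extractionS_of_pointwise (p : unitInterval) (m₁ m₂ m₃ m₄ M : ℕ) (x : Site d)
    (S₁ S₂ S₃ : Finset (Site d)) {D : Site d → Site d → Site d → ℝ}
    (hpt : ∀ v ∈ S₁, ∀ y ∈ S₂, ∀ w ∈ S₃, D v y w ≤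
      (∑ t ∈ idxExplicitS m₁ m₂ m₃ m₄ M x v y w, (p : ℝ) ^ t.1) +
        (∑ t ∈ idxOneTailS (d := d) m₁ m₂ m₃ m₄ M v y w, (p : ℝ) ^ M * tau d p (wordPos t.1 M) x) +
          (∑ t ∈ idxTwoTailS (d := d) m₁ m₂ m₃ m₄ M v y,
            (p : ℝ) ^ (M - m₄) * (p : ℝ) ^ m₄ *
              (tau d p (wordPos t.1.1 (M - m₄)) w * tau d p (w + wordPos t.2 m₄) x)) +
            (∑ t ∈ idxThreeTailS (d := d) m₁ m₂ m₃ m₄ M v,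
              (p : ℝ) ^ (M - (m₃ + m₄)) * (p : ℝ) ^ m₃ * (p : ℝ) ^ m₄ *
                (tau d p (wordPos t.1.1 (M - (m₃ + m₄))) y * tau d p (y + wordPos t.2.1 m₃) w *
                  tau d p (w + wordPos t.2.2 m₄) x)) +
              ∑ t ∈ idxFourTailS (d := d) m₂ m₃ m₄ M,
                (p : ℝ) ^ (M - (m₂ + m₃ + m₄)) * (p : ℝ) ^ m₂ * (p : ℝ) ^ m₃ * (p : ℝ) ^ m₄ *
                  (tau d p (wordPos t.1 (M - (m₂ + m₃ + m₄))) v * tau d p (v + wordPos t.2.1 m₂) y *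
                    tau d p (y + wordPos t.2.2.1 m₃) w * tau d p (w + wordPos t.2.2.2 m₄) x)) :
    ∑ v ∈ S₁, ∑ y ∈ S₂, ∑ w ∈ S₃, D v y w ≤
      (∑ L ∈ Finset.Ico (m₁ + m₂ + m₃ + m₄) M,
          ((sqTriplesE m₁ m₂ m₃ m₄ L).card : ℝ) * ((trailWordsTo d L x).card : ℝ) * (p : ℝ) ^ L) +
        ((sqTriplesO m₁ m₂ m₃ m₄ M).card : ℝ) * ((p : ℝ) ^ M * ∑ u ∈ trailWords d M, tau d p 0 (x - wordPos u M)) +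
          ((triPairsO m₁ m₂ m₃ (M - m₄)).card : ℝ) * ((p : ℝ) ^ (M - m₄) * (p : ℝ) ^ m₄ *
            ∑ uu ∈ idxTwoTail (d := d) m₄ M,
              ∑ w ∈ S₃, tau d p (wordPos uu.1 (M - m₄)) w * tau d p (w + wordPos uu.2 m₄) x) +
            ((Finset.Ico m₁ (M - (m₂ + m₃ + m₄))).card : ℝ) *
              ((p : ℝ) ^ (M - (m₃ + m₄)) * (p : ℝ) ^ m₃ * (p : ℝ) ^ m₄ *
                ∑ t ∈ idxThreeTailT (d := d) m₃ m₄ M, ∑ y ∈ S₂, ∑ w ∈ S₃,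
                  tau d p (wordPos t.1 (M - (m₃ + m₄))) y * tau d p (y + wordPos t.2.1 m₃) w *
                    tau d p (w + wordPos t.2.2 m₄) x) +
              (p : ℝ) ^ (M - (m₂ + m₃ + m₄)) * (p : ℝ) ^ m₂ * (p : ℝ) ^ m₃ * (p : ℝ) ^ m₄ *
                ∑ t ∈ idxFourTailS (d := d) m₂ m₃ m₄ M, ∑ v ∈ S₁, ∑ y ∈ S₂, ∑ w ∈ S₃,
                  tau d p (wordPos t.1 (M - (m₂ + m₃ + m₄))) v * tau d p (v + wordPos t.2.1 m₂) y *
                    tau d p (y + wordPos t.2.2.1 m₃) w * tau d p (w + wordPos t.2.2.2 m₄) x := by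
  classical
  have hp0 : 0 ≤ (p : ℝ) := p.2.1
  set fE : (Σ L : ℕ, (Fin L → Fin d × Bool) × ℕ × ℕ × ℕ) → ℝ := fun t => (p : ℝ) ^ t.1 with hfE
  set fO : ((Fin M → Fin d × Bool) × ℕ × ℕ × ℕ) → ℝ := fun t => (p : ℝ) ^ M * tau d p (wordPos t.1 M) x with hfO
  set f2 : Site d → (((Fin (M - m₄) → Fin d × Bool) × ℕ × ℕ) × (Fin m₄ → Fin d × Bool)) → ℝ := fun w t =>
    (p : ℝ) ^ (M - m₄) * (p : ℝ) ^ m₄ * (tau d p (wordPos t.1.1 (M - m₄)) w * tau d p (w + wordPos t.2 m₄) x)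
    with hf2
  set f3 : Site d → Site d →
      (((Fin (M - (m₃ + m₄)) → Fin d × Bool) × ℕ) × (Fin m₃ → Fin d × Bool) × (Fin m₄ → Fin d × Bool)) → ℝ :=
    fun y w t => (p : ℝ) ^ (M - (m₃ + m₄)) * (p : ℝ) ^ m₃ * (p : ℝ) ^ m₄ *
      (tau d p (wordPos t.1.1 (M - (m₃ + m₄))) y * tau d p (y + wordPos t.2.1 m₃) w * tau d p (w + wordPos t.2.2 m₄) x)
    with hf3
  set f4 : Site d → Site d → Site d →
      ((Fin (M - (m₂ + m₃ + m₄)) → Fin d × Bool) × (Fin m₂ → Fin d × Bool) × (Fin m₃ → Fin d × Bool) ×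
        (Fin m₄ → Fin d × Bool)) → ℝ :=
    fun v y w t => (p : ℝ) ^ (M - (m₂ + m₃ + m₄)) * (p : ℝ) ^ m₂ * (p : ℝ) ^ m₃ * (p : ℝ) ^ m₄ *
      (tau d p (wordPos t.1 (M - (m₂ + m₃ + m₄))) v * tau d p (v + wordPos t.2.1 m₂) y *
        tau d p (y + wordPos t.2.2.1 m₃) w * tau d p (w + wordPos t.2.2.2 m₄) x) with hf4
  have hsum : ∑ v ∈ S₁, ∑ y ∈ S₂, ∑ w ∈ S₃, D v y w ≤ ∑ v ∈ S₁, ∑ y ∈ S₂, ∑ w ∈ S₃,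
      ((∑ t ∈ idxExplicitS m₁ m₂ m₃ m₄ M x v y w, fE t) + (∑ t ∈ idxOneTailS (d := d) m₁ m₂ m₃ m₄ M v y w, fO t) +
        (∑ t ∈ idxTwoTailS (d := d) m₁ m₂ m₃ m₄ M v y, f2 w t) +
          (∑ t ∈ idxThreeTailS (d := d) m₁ m₂ m₃ m₄ M v, f3 y w t) +
            ∑ t ∈ idxFourTailS (d := d) m₂ m₃ m₄ M, f4 v y w t) :=
    Finset.sum_le_sum fun v hv => Finset.sum_le_sum fun y hy => Finset.sum_le_sum fun w hw => hpt v hv y hy w hw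
  simp only [Finset.sum_add_distrib] at hsum
  refine hsum.trans (add_le_add (add_le_add (add_le_add (add_le_add ?_ ?_) ?_) ?_) (le_of_eq ?_))
  · -- explicit family
    calc ∑ v ∈ S₁, ∑ y ∈ S₂, ∑ w ∈ S₃, ∑ t ∈ idxExplicitS m₁ m₂ m₃ m₄ M x v y w, fE t
        ≤ ∑ t ∈ baseExplicitS m₁ m₂ m₃ m₄ M x, fE t :=
          sum3_filter_filter_le S₁ S₂ S₃ (baseExplicitS m₁ m₂ m₃ m₄ M x) (fun t => wordPos t.2.1 t.2.2.1)
            (fun t => wordPos t.2.1 t.2.2.2.1) (fun t => wordPos t.2.1 t.2.2.2.2) (fun t _ => pow_nonneg hp0 _)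
      _ = ∑ L ∈ Finset.Ico (m₁ + m₂ + m₃ + m₄) M,
            ((sqTriplesE m₁ m₂ m₃ m₄ L).card : ℝ) * ((trailWordsTo d L x).card : ℝ) * (p : ℝ) ^ L := by
          rw [baseExplicitS, Finset.sum_sigma]
          refine Finset.sum_congr rfl fun L _ => ?_
          rw [hfE]
          simp only [Finset.sum_const, Finset.card_product, nsmul_eq_mul, Nat.cast_mul]
          ring
  · -- one-tail family
    calc ∑ v ∈ S₁, ∑ y ∈ S₂, ∑ w ∈ S₃, ∑ t ∈ idxOneTailS (d := d) m₁ m₂ m₃ m₄ M v y w, fO t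
        ≤ ∑ t ∈ baseOneTailS (d := d) m₁ m₂ m₃ m₄ M, fO t :=
          sum3_filter_filter_le S₁ S₂ S₃ (baseOneTailS (d := d) m₁ m₂ m₃ m₄ M) (fun t => wordPos t.1 t.2.1)
            (fun t => wordPos t.1 t.2.2.1) (fun t => wordPos t.1 t.2.2.2)
            (fun t _ => mul_nonneg (pow_nonneg hp0 M) (tau_nonneg p _ _))
      _ = ((sqTriplesO m₁ m₂ m₃ m₄ M).card : ℝ) *
            ((p : ℝ) ^ M * ∑ u ∈ trailWords d M, tau d p 0 (x - wordPos u M)) := by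
          rw [baseOneTailS, Finset.sum_product, Finset.mul_sum, Finset.mul_sum]
          refine Finset.sum_congr rfl fun u _ => ?_
          rw [hfO]
          simp only [Finset.sum_const, nsmul_eq_mul, tau_eq_tau_zero_sub p (wordPos u M) x]
  · -- two-tail family
    calc ∑ v ∈ S₁, ∑ y ∈ S₂, ∑ w ∈ S₃, ∑ t ∈ idxTwoTailS (d := d) m₁ m₂ m₃ m₄ M v y, f2 w t
        = ∑ v ∈ S₁, ∑ y ∈ S₂, ∑ t ∈ idxTwoTailS (d := d) m₁ m₂ m₃ m₄ M v y, ∑ w ∈ S₃, f2 w t :=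
          Finset.sum_congr rfl fun v _ => Finset.sum_congr rfl fun y _ => Finset.sum_comm
      _ ≤ ∑ t ∈ baseTwoTailS (d := d) m₁ m₂ m₃ m₄ M, ∑ w ∈ S₃, f2 w t :=
          sum_sum_sum_filter_le S₁ S₂ (baseTwoTailS (d := d) m₁ m₂ m₃ m₄ M) (fun t => wordPos t.1.1 t.1.2.1)
            (fun t => wordPos t.1.1 t.1.2.2)
            (fun t _ => Finset.sum_nonneg fun w _ => by
              rw [hf2]
              exact mul_nonneg (mul_nonneg (pow_nonneg hp0 _) (pow_nonneg hp0 _))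
                (mul_nonneg (tau_nonneg p _ _) (tau_nonneg p _ _)))
      _ = ((triPairsO m₁ m₂ m₃ (M - m₄)).card : ℝ) * ((p : ℝ) ^ (M - m₄) * (p : ℝ) ^ m₄ *
            ∑ uu ∈ idxTwoTail (d := d) m₄ M,
              ∑ w ∈ S₃, tau d p (wordPos uu.1 (M - m₄)) w * tau d p (w + wordPos uu.2 m₄) x) := by
          rw [baseTwoTailS, idxTwoTail, Finset.sum_product, Finset.sum_product, Finset.sum_product, Finset.mul_sum,
            Finset.mul_sum]
          refine Finset.sum_congr rfl fun u₁ _ => ?_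
          rw [Finset.mul_sum, Finset.mul_sum, Finset.sum_comm]
          refine Finset.sum_congr rfl fun u₄ _ => ?_
          simp only [hf2]
          rw [Finset.sum_const, nsmul_eq_mul]
          congr 1
          rw [Finset.mul_sum]
  · -- three-tail family
    calc ∑ v ∈ S₁, ∑ y ∈ S₂, ∑ w ∈ S₃, ∑ t ∈ idxThreeTailS (d := d) m₁ m₂ m₃ m₄ M v, f3 y w t
        = ∑ v ∈ S₁, ∑ y ∈ S₂, ∑ t ∈ idxThreeTailS (d := d) m₁ m₂ m₃ m₄ M v, ∑ w ∈ S₃, f3 y w t :=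
          Finset.sum_congr rfl fun v _ => Finset.sum_congr rfl fun y _ => Finset.sum_comm
      _ = ∑ v ∈ S₁, ∑ t ∈ idxThreeTailS (d := d) m₁ m₂ m₃ m₄ M v, ∑ y ∈ S₂, ∑ w ∈ S₃, f3 y w t :=
          Finset.sum_congr rfl fun v _ => Finset.sum_comm
      _ ≤ ∑ t ∈ baseThreeTailS (d := d) m₁ m₂ m₃ m₄ M, ∑ y ∈ S₂, ∑ w ∈ S₃, f3 y w t :=
          sum_sum_filter_le S₁ (baseThreeTailS (d := d) m₁ m₂ m₃ m₄ M) (fun t => wordPos t.1.1 t.1.2)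
            (fun t _ => Finset.sum_nonneg fun y _ => Finset.sum_nonneg fun w _ => by
              rw [hf3]
              exact mul_nonneg (mul_nonneg (mul_nonneg (pow_nonneg hp0 _) (pow_nonneg hp0 _)) (pow_nonneg hp0 _))
                (mul_nonneg (mul_nonneg (tau_nonneg p _ _) (tau_nonneg p _ _)) (tau_nonneg p _ _)))
      _ = ((Finset.Ico m₁ (M - (m₂ + m₃ + m₄))).card : ℝ) *
            ((p : ℝ) ^ (M - (m₃ + m₄)) * (p : ℝ) ^ m₃ * (p : ℝ) ^ m₄ *
              ∑ t ∈ idxThreeTailT (d := d) m₃ m₄ M, ∑ y ∈ S₂, ∑ w ∈ S₃,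
                tau d p (wordPos t.1 (M - (m₃ + m₄))) y * tau d p (y + wordPos t.2.1 m₃) w *
                  tau d p (w + wordPos t.2.2 m₄) x) := by
          rw [baseThreeTailS, idxThreeTailT,
            Finset.sum_product ((trailWords d (M - (m₃ + m₄))) ×ˢ (Finset.Ico m₁ (M - (m₂ + m₃ + m₄))))
              ((trailWords d m₃) ×ˢ (trailWords d m₄)),
            Finset.sum_product (trailWords d (M - (m₃ + m₄))) (Finset.Ico m₁ (M - (m₂ + m₃ + m₄))),
            Finset.sum_product (trailWords d (M - (m₃ + m₄))) ((trailWords d m₃) ×ˢ (trailWords d m₄)),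
            Finset.mul_sum, Finset.mul_sum]
          refine Finset.sum_congr rfl fun u₁ _ => ?_
          simp only [hf3, Finset.mul_sum, Finset.sum_const, nsmul_eq_mul]
  · -- four-tail family
    rw [Finset.mul_sum]
    calc ∑ v ∈ S₁, ∑ y ∈ S₂, ∑ w ∈ S₃, ∑ t ∈ idxFourTailS (d := d) m₂ m₃ m₄ M, f4 v y w t
        = ∑ v ∈ S₁, ∑ y ∈ S₂, ∑ t ∈ idxFourTailS (d := d) m₂ m₃ m₄ M, ∑ w ∈ S₃, f4 v y w t :=
          Finset.sum_congr rfl fun v _ => Finset.sum_congr rfl fun y _ => Finset.sum_comm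
      _ = ∑ v ∈ S₁, ∑ t ∈ idxFourTailS (d := d) m₂ m₃ m₄ M, ∑ y ∈ S₂, ∑ w ∈ S₃, f4 v y w t :=
          Finset.sum_congr rfl fun v _ => Finset.sum_comm
      _ = ∑ t ∈ idxFourTailS (d := d) m₂ m₃ m₄ M, ∑ v ∈ S₁, ∑ y ∈ S₂, ∑ w ∈ S₃, f4 v y w t := Finset.sum_comm
      _ = _ := by
          refine Finset.sum_congr rfl fun t _ => ?_
          rw [hf4, Finset.mul_sum]
          refine Finset.sum_congr rfl fun v _ => ?_
          rw [Finset.mul_sum]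
          refine Finset.sum_congr rfl fun y _ => ?_
          rw [Finset.mul_sum]

/-- **Conversion of the multiplicities to binomial coefficients** (as `sum3_diagS_le_extraction_choose`):
`#sqTriplesE(L) = C(L+3−m_{1,4},3)` for `L ≥ m_{1,4}`, `#sqTriplesO(M) = C(M+2−m_{1,4},3)`,
`#triPairsO(M−m₄) = C(M+1−m_{1,4},2)`, `#Ico = M − m_{1,4}`. [cite: FitznerVanDerHofstad2016NoBLE, §5.3.2 (5.42) PTRF p. 1098] -/
theorem le_extractionS_choose_of_le (p : unitInterval) (m₁ m₂ m₃ m₄ M : ℕ) (x : Site d)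
    (S₁ S₂ S₃ : Finset (Site d)) {a : ℝ}
    (h : a ≤
      (∑ L ∈ Finset.Ico (m₁ + m₂ + m₃ + m₄) M,
          ((sqTriplesE m₁ m₂ m₃ m₄ L).card : ℝ) * ((trailWordsTo d L x).card : ℝ) * (p : ℝ) ^ L) +
        ((sqTriplesO m₁ m₂ m₃ m₄ M).card : ℝ) * ((p : ℝ) ^ M * ∑ u ∈ trailWords d M, tau d p 0 (x - wordPos u M)) +
          ((triPairsO m₁ m₂ m₃ (M - m₄)).card : ℝ) * ((p : ℝ) ^ (M - m₄) * (p : ℝ) ^ m₄ *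
            ∑ uu ∈ idxTwoTail (d := d) m₄ M,
              ∑ w ∈ S₃, tau d p (wordPos uu.1 (M - m₄)) w * tau d p (w + wordPos uu.2 m₄) x) +
            ((Finset.Ico m₁ (M - (m₂ + m₃ + m₄))).card : ℝ) *
              ((p : ℝ) ^ (M - (m₃ + m₄)) * (p : ℝ) ^ m₃ * (p : ℝ) ^ m₄ *
                ∑ t ∈ idxThreeTailT (d := d) m₃ m₄ M, ∑ y ∈ S₂, ∑ w ∈ S₃,
                  tau d p (wordPos t.1 (M - (m₃ + m₄))) y * tau d p (y + wordPos t.2.1 m₃) w *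
                    tau d p (w + wordPos t.2.2 m₄) x) +
              (p : ℝ) ^ (M - (m₂ + m₃ + m₄)) * (p : ℝ) ^ m₂ * (p : ℝ) ^ m₃ * (p : ℝ) ^ m₄ *
                ∑ t ∈ idxFourTailS (d := d) m₂ m₃ m₄ M, ∑ v ∈ S₁, ∑ y ∈ S₂, ∑ w ∈ S₃,
                  tau d p (wordPos t.1 (M - (m₂ + m₃ + m₄))) v * tau d p (v + wordPos t.2.1 m₂) y *
                    tau d p (y + wordPos t.2.2.1 m₃) w * tau d p (w + wordPos t.2.2.2 m₄) x) :
    a ≤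
      (∑ L ∈ Finset.Ico (m₁ + m₂ + m₃ + m₄) M,
          (((L + 3 - (m₁ + m₂ + m₃ + m₄)).choose 3 : ℕ) : ℝ) * ((trailWordsTo d L x).card : ℝ) * (p : ℝ) ^ L) +
        (((M + 2 - (m₁ + m₂ + m₃ + m₄)).choose 3 : ℕ) : ℝ) *
            ((p : ℝ) ^ M * ∑ u ∈ trailWords d M, tau d p 0 (x - wordPos u M)) +
          (((M + 1 - (m₁ + m₂ + m₃ + m₄)).choose 2 : ℕ) : ℝ) * ((p : ℝ) ^ (M - m₄) * (p : ℝ) ^ m₄ *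
            ∑ uu ∈ idxTwoTail (d := d) m₄ M,
              ∑ w ∈ S₃, tau d p (wordPos uu.1 (M - m₄)) w * tau d p (w + wordPos uu.2 m₄) x) +
            ((M - (m₁ + m₂ + m₃ + m₄) : ℕ) : ℝ) *
              ((p : ℝ) ^ (M - (m₃ + m₄)) * (p : ℝ) ^ m₃ * (p : ℝ) ^ m₄ *
                ∑ t ∈ idxThreeTailT (d := d) m₃ m₄ M, ∑ y ∈ S₂, ∑ w ∈ S₃,
                  tau d p (wordPos t.1 (M - (m₃ + m₄))) y * tau d p (y + wordPos t.2.1 m₃) w *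
                    tau d p (w + wordPos t.2.2 m₄) x) +
              (p : ℝ) ^ (M - (m₂ + m₃ + m₄)) * (p : ℝ) ^ m₂ * (p : ℝ) ^ m₃ * (p : ℝ) ^ m₄ *
                ∑ t ∈ idxFourTailS (d := d) m₂ m₃ m₄ M, ∑ v ∈ S₁, ∑ y ∈ S₂, ∑ w ∈ S₃,
                  tau d p (wordPos t.1 (M - (m₂ + m₃ + m₄))) v * tau d p (v + wordPos t.2.1 m₂) y *
                    tau d p (y + wordPos t.2.2.1 m₃) w * tau d p (w + wordPos t.2.2.2 m₄) x := by
  have hE : (∑ L ∈ Finset.Ico (m₁ + m₂ + m₃ + m₄) M,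
      ((sqTriplesE m₁ m₂ m₃ m₄ L).card : ℝ) * ((trailWordsTo d L x).card : ℝ) * (p : ℝ) ^ L) =
      ∑ L ∈ Finset.Ico (m₁ + m₂ + m₃ + m₄) M,
        (((L + 3 - (m₁ + m₂ + m₃ + m₄)).choose 3 : ℕ) : ℝ) * ((trailWordsTo d L x).card : ℝ) * (p : ℝ) ^ L :=
    Finset.sum_congr rfl fun L hL => by rw [card_sqTriplesE_eq_choose (Finset.mem_Ico.1 hL).1]
  rw [hE, card_sqTriplesO_eq_choose, card_sqTwoTail_eq_choose, card_sqThreeTail_eq] at h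
  exact h

/-! ### H. The summed bounds for every member and for the maximum; the slot form -/

/-- **[NoBLE17] (5.42) for the square member on configurations `c`, summed over `v ∈ S₁`, `y ∈ S₂`, `w ∈ S₃`** — the
same right-hand side as `sum3_diagS_le_extraction`. [cite: FitznerVanDerHofstad2016NoBLE, §5.3.2 (5.42) PTRF p. 1098]
[cite: FitznerVanDerHofstad2017, §4.2 (4.17)–(4.18) and the display after (4.18) (arXiv:1506.07977v2 p. 36 = EJP p. 33)] -/
theorem sum3_diagSL_le_extraction {k : ℕ} (c : Fin 4 → Fin k) (p : unitInterval) (m₁ m₂ m₃ m₄ M : ℕ)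
    (x : Site d) (S₁ S₂ S₃ : Finset (Site d)) :
    ∑ v ∈ S₁, ∑ y ∈ S₂, ∑ w ∈ S₃, diagSL d k p c m₁ m₂ m₃ m₄ v y w x ≤
      (∑ L ∈ Finset.Ico (m₁ + m₂ + m₃ + m₄) M,
          ((sqTriplesE m₁ m₂ m₃ m₄ L).card : ℝ) * ((trailWordsTo d L x).card : ℝ) * (p : ℝ) ^ L) +
        ((sqTriplesO m₁ m₂ m₃ m₄ M).card : ℝ) * ((p : ℝ) ^ M * ∑ u ∈ trailWords d M, tau d p 0 (x - wordPos u M)) +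
          ((triPairsO m₁ m₂ m₃ (M - m₄)).card : ℝ) * ((p : ℝ) ^ (M - m₄) * (p : ℝ) ^ m₄ *
            ∑ uu ∈ idxTwoTail (d := d) m₄ M,
              ∑ w ∈ S₃, tau d p (wordPos uu.1 (M - m₄)) w * tau d p (w + wordPos uu.2 m₄) x) +
            ((Finset.Ico m₁ (M - (m₂ + m₃ + m₄))).card : ℝ) *
              ((p : ℝ) ^ (M - (m₃ + m₄)) * (p : ℝ) ^ m₃ * (p : ℝ) ^ m₄ *
                ∑ t ∈ idxThreeTailT (d := d) m₃ m₄ M, ∑ y ∈ S₂, ∑ w ∈ S₃,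
                  tau d p (wordPos t.1 (M - (m₃ + m₄))) y * tau d p (y + wordPos t.2.1 m₃) w *
                    tau d p (w + wordPos t.2.2 m₄) x) +
              (p : ℝ) ^ (M - (m₂ + m₃ + m₄)) * (p : ℝ) ^ m₂ * (p : ℝ) ^ m₃ * (p : ℝ) ^ m₄ *
                ∑ t ∈ idxFourTailS (d := d) m₂ m₃ m₄ M, ∑ v ∈ S₁, ∑ y ∈ S₂, ∑ w ∈ S₃,
                  tau d p (wordPos t.1 (M - (m₂ + m₃ + m₄))) v * tau d p (v + wordPos t.2.1 m₂) y *
                    tau d p (y + wordPos t.2.2.1 m₃) w * tau d p (w + wordPos t.2.2.2 m₄) x :=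
  sum3_le_extractionS_of_pointwise p m₁ m₂ m₃ m₄ M x S₁ S₂ S₃ fun v _ y _ w _ =>
    diagSL_le_extraction c p m₁ m₂ m₃ m₄ M x v y w

/-- **The repulsive square (maximum over the assignments `(1,i,j,l)`) by extraction, summed over `v ∈ S₁`, `y ∈ S₂`,
`w ∈ S₃`** — right-hand side of `sum3_diagS_le_extraction`.
[cite: FitznerVanDerHofstad2017, §4.2 (4.17) and the sentence after it (arXiv:1506.07977v2 p. 36 = EJP p. 33)]
[cite: FitznerVanDerHofstad2016NoBLE, §5.3.2 (5.42) PTRF p. 1098] -/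
theorem sum3_repSquare_le_extraction (p : unitInterval) (m₁ m₂ m₃ m₄ M : ℕ) (x : Site d)
    (S₁ S₂ S₃ : Finset (Site d)) :
    ∑ v ∈ S₁, ∑ y ∈ S₂, ∑ w ∈ S₃, repSquare d p m₁ m₂ m₃ m₄ v y w x ≤
      (∑ L ∈ Finset.Ico (m₁ + m₂ + m₃ + m₄) M,
          ((sqTriplesE m₁ m₂ m₃ m₄ L).card : ℝ) * ((trailWordsTo d L x).card : ℝ) * (p : ℝ) ^ L) +
        ((sqTriplesO m₁ m₂ m₃ m₄ M).card : ℝ) * ((p : ℝ) ^ M * ∑ u ∈ trailWords d M, tau d p 0 (x - wordPos u M)) +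
          ((triPairsO m₁ m₂ m₃ (M - m₄)).card : ℝ) * ((p : ℝ) ^ (M - m₄) * (p : ℝ) ^ m₄ *
            ∑ uu ∈ idxTwoTail (d := d) m₄ M,
              ∑ w ∈ S₃, tau d p (wordPos uu.1 (M - m₄)) w * tau d p (w + wordPos uu.2 m₄) x) +
            ((Finset.Ico m₁ (M - (m₂ + m₃ + m₄))).card : ℝ) *
              ((p : ℝ) ^ (M - (m₃ + m₄)) * (p : ℝ) ^ m₃ * (p : ℝ) ^ m₄ *
                ∑ t ∈ idxThreeTailT (d := d) m₃ m₄ M, ∑ y ∈ S₂, ∑ w ∈ S₃,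
                  tau d p (wordPos t.1 (M - (m₃ + m₄))) y * tau d p (y + wordPos t.2.1 m₃) w *
                    tau d p (w + wordPos t.2.2 m₄) x) +
              (p : ℝ) ^ (M - (m₂ + m₃ + m₄)) * (p : ℝ) ^ m₂ * (p : ℝ) ^ m₃ * (p : ℝ) ^ m₄ *
                ∑ t ∈ idxFourTailS (d := d) m₂ m₃ m₄ M, ∑ v ∈ S₁, ∑ y ∈ S₂, ∑ w ∈ S₃,
                  tau d p (wordPos t.1 (M - (m₂ + m₃ + m₄))) v * tau d p (v + wordPos t.2.1 m₂) y *
                    tau d p (y + wordPos t.2.2.1 m₃) w * tau d p (w + wordPos t.2.2.2 m₄) x :=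
  sum3_le_extractionS_of_pointwise p m₁ m₂ m₃ m₄ M x S₁ S₂ S₃ fun v _ y _ w _ =>
    repSquare_le_extraction p m₁ m₂ m₃ m₄ M x v y w

/-- **The square by extraction with binomial multiplicities** (`C(L+3−m,3)`, `C(M+2−m,3)`, `C(M+1−m,2)`, `M−m`, `1`).
[cite: FitznerVanDerHofstad2016NoBLE, §5.3.2 (5.42) PTRF p. 1098]
[cite: FitznerVanDerHofstad2017, §4.2 (4.17) and the sentence after it (arXiv:1506.07977v2 p. 36 = EJP p. 33)] -/
theorem sum3_repSquare_le_extraction_choose (p : unitInterval) (m₁ m₂ m₃ m₄ M : ℕ) (x : Site d)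
    (S₁ S₂ S₃ : Finset (Site d)) :
    ∑ v ∈ S₁, ∑ y ∈ S₂, ∑ w ∈ S₃, repSquare d p m₁ m₂ m₃ m₄ v y w x ≤
      (∑ L ∈ Finset.Ico (m₁ + m₂ + m₃ + m₄) M,
          (((L + 3 - (m₁ + m₂ + m₃ + m₄)).choose 3 : ℕ) : ℝ) * ((trailWordsTo d L x).card : ℝ) * (p : ℝ) ^ L) +
        (((M + 2 - (m₁ + m₂ + m₃ + m₄)).choose 3 : ℕ) : ℝ) *
            ((p : ℝ) ^ M * ∑ u ∈ trailWords d M, tau d p 0 (x - wordPos u M)) +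
          (((M + 1 - (m₁ + m₂ + m₃ + m₄)).choose 2 : ℕ) : ℝ) * ((p : ℝ) ^ (M - m₄) * (p : ℝ) ^ m₄ *
            ∑ uu ∈ idxTwoTail (d := d) m₄ M,
              ∑ w ∈ S₃, tau d p (wordPos uu.1 (M - m₄)) w * tau d p (w + wordPos uu.2 m₄) x) +
            ((M - (m₁ + m₂ + m₃ + m₄) : ℕ) : ℝ) *
              ((p : ℝ) ^ (M - (m₃ + m₄)) * (p : ℝ) ^ m₃ * (p : ℝ) ^ m₄ *
                ∑ t ∈ idxThreeTailT (d := d) m₃ m₄ M, ∑ y ∈ S₂, ∑ w ∈ S₃,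
                  tau d p (wordPos t.1 (M - (m₃ + m₄))) y * tau d p (y + wordPos t.2.1 m₃) w *
                    tau d p (w + wordPos t.2.2 m₄) x) +
              (p : ℝ) ^ (M - (m₂ + m₃ + m₄)) * (p : ℝ) ^ m₂ * (p : ℝ) ^ m₃ * (p : ℝ) ^ m₄ *
                ∑ t ∈ idxFourTailS (d := d) m₂ m₃ m₄ M, ∑ v ∈ S₁, ∑ y ∈ S₂, ∑ w ∈ S₃,
                  tau d p (wordPos t.1 (M - (m₂ + m₃ + m₄))) v * tau d p (v + wordPos t.2.1 m₂) y *
                    tau d p (y + wordPos t.2.2.1 m₃) w * tau d p (w + wordPos t.2.2.2 m₄) x :=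
  le_extractionS_choose_of_le p m₁ m₂ m₃ m₄ M x S₁ S₂ S₃ (sum3_repSquare_le_extraction p m₁ m₂ m₃ m₄ M x S₁ S₂ S₃)

/-- **The square member on configurations `c` at abstract remainder-kernel slots** (`d ≥ 2`, `p < p_c`,
`m₂ + m₃ + m₄ ≤ M`, `x ∈ X`, `R₁, …, R₄` valid remainder constants):
`Σ_{v,y,w} ℙ^{⊗k}(member c) ≤ Σ_L C(L+3−m,3) a_L(x) p^L + C(M+2−m,3) p^M Γ̄₂ R₁ + C(M+1−m,2) p^M Γ̄₂² R₂ + (M−m) p^M Γ̄₂³ R₃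
+ p^M Γ̄₂⁴ R₄`. [cite: FitznerVanDerHofstad2016NoBLE, §5.3.2 (5.42) p. 1098; (5.39) p. 1097]
[cite: FitznerVanDerHofstad2017, §4.2 (4.17); notebook Percolation.nb cells 11, 12] -/
theorem sum3_diagSL_le_slots (hd : 2 ≤ d) {k : ℕ} (c : Fin 4 → Fin k) (p : unitInterval) (hp : p < criticalProbI d)
    {m₁ m₂ m₃ m₄ M : ℕ} (hm : m₂ + m₃ + m₄ ≤ M) {x : Site d} {X : Set (Site d)} (hx : x ∈ X) {R₁ R₂ R₃ R₄ : ℝ}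
    (hR₁ : IsRemKernelConst d [M] X R₁) (hR₂ : IsRemKernelConst d [M - m₄, m₄] X R₂)
    (hR₃ : IsRemKernelConst d [M - (m₃ + m₄), m₃, m₄] X R₃)
    (hR₄ : IsRemKernelConst d [M - (m₂ + m₃ + m₄), m₂, m₃, m₄] X R₄) (S₁ S₂ S₃ : Finset (Site d)) :
    ∑ v ∈ S₁, ∑ y ∈ S₂, ∑ w ∈ S₃, diagSL d k p c m₁ m₂ m₃ m₄ v y w x ≤
      (∑ L ∈ Finset.Ico (m₁ + m₂ + m₃ + m₄) M,
          (((L + 3 - (m₁ + m₂ + m₃ + m₄)).choose 3 : ℕ) : ℝ) * ((trailWordsTo d L x).card : ℝ) * (p : ℝ) ^ L) +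
        (((M + 2 - (m₁ + m₂ + m₃ + m₄)).choose 3 : ℕ) : ℝ) * ((p : ℝ) ^ M * (nobleSup2 d p * R₁)) +
          (((M + 1 - (m₁ + m₂ + m₃ + m₄)).choose 2 : ℕ) : ℝ) * ((p : ℝ) ^ M * (nobleSup2 d p ^ 2 * R₂)) +
            ((M - (m₁ + m₂ + m₃ + m₄) : ℕ) : ℝ) * ((p : ℝ) ^ M * (nobleSup2 d p ^ 3 * R₃)) +
              (p : ℝ) ^ M * (nobleSup2 d p ^ 4 * R₄) :=
  sum3_le_repSquare_slots (D := fun v y w => diagSL d k p c m₁ m₂ m₃ m₄ v y w x)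
    (fun S₁ S₂ S₃ => le_extractionS_choose_of_le p m₁ m₂ m₃ m₄ M x S₁ S₂ S₃
      (sum3_diagSL_le_extraction c p m₁ m₂ m₃ m₄ M x S₁ S₂ S₃))
    hd hp hm (Nat.cast_nonneg _) hx hR₁ hR₂ hR₃ hR₄ S₁ S₂ S₃

/-- **The repulsive square `𝓢_{m₁,…,m₄}(v,y,w,x)` (maximum over the assignments `(1,i,j,l)` on four i.i.d.
configurations) at abstract remainder-kernel slots** (`d ≥ 2`, `p < p_c`, `m₂ + m₃ + m₄ ≤ M`, `x ∈ X`):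
`Σ_{v,y,w} 𝓢 ≤ Σ_L C(L+3−m,3) a_L(x) p^L + C(M+2−m,3) p^M Γ̄₂ R₁ + C(M+1−m,2) p^M Γ̄₂² R₂ + (M−m) p^M Γ̄₂³ R₃ + p^M Γ̄₂⁴ R₄`
— (5.42) with each tail a slot; cells 11/12 of `Percolation.nb`.
[cite: FitznerVanDerHofstad2017, §4.2 (4.17) and the sentence after it (arXiv:1506.07977v2 p. 36 = EJP p. 33); notebook Percolation.nb cells 11, 12]
[cite: FitznerVanDerHofstad2016NoBLE, §5.3.2 (5.42) p. 1098; (5.39) p. 1097] -/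
theorem sum3_repSquare_le_slots (hd : 2 ≤ d) (p : unitInterval) (hp : p < criticalProbI d)
    {m₁ m₂ m₃ m₄ M : ℕ} (hm : m₂ + m₃ + m₄ ≤ M) {x : Site d} {X : Set (Site d)} (hx : x ∈ X) {R₁ R₂ R₃ R₄ : ℝ}
    (hR₁ : IsRemKernelConst d [M] X R₁) (hR₂ : IsRemKernelConst d [M - m₄, m₄] X R₂)
    (hR₃ : IsRemKernelConst d [M - (m₃ + m₄), m₃, m₄] X R₃)
    (hR₄ : IsRemKernelConst d [M - (m₂ + m₃ + m₄), m₂, m₃, m₄] X R₄) (S₁ S₂ S₃ : Finset (Site d)) :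
    ∑ v ∈ S₁, ∑ y ∈ S₂, ∑ w ∈ S₃, repSquare d p m₁ m₂ m₃ m₄ v y w x ≤
      (∑ L ∈ Finset.Ico (m₁ + m₂ + m₃ + m₄) M,
          (((L + 3 - (m₁ + m₂ + m₃ + m₄)).choose 3 : ℕ) : ℝ) * ((trailWordsTo d L x).card : ℝ) * (p : ℝ) ^ L) +
        (((M + 2 - (m₁ + m₂ + m₃ + m₄)).choose 3 : ℕ) : ℝ) * ((p : ℝ) ^ M * (nobleSup2 d p * R₁)) +
          (((M + 1 - (m₁ + m₂ + m₃ + m₄)).choose 2 : ℕ) : ℝ) * ((p : ℝ) ^ M * (nobleSup2 d p ^ 2 * R₂)) +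
            ((M - (m₁ + m₂ + m₃ + m₄) : ℕ) : ℝ) * ((p : ℝ) ^ M * (nobleSup2 d p ^ 3 * R₃)) +
              (p : ℝ) ^ M * (nobleSup2 d p ^ 4 * R₄) :=
  sum3_le_repSquare_slots (D := fun v y w => repSquare d p m₁ m₂ m₃ m₄ v y w x)
    (sum3_repSquare_le_extraction_choose p m₁ m₂ m₃ m₄ M x) hd hp hm (Nat.cast_nonneg _) hx hR₁ hR₂ hR₃ hR₄ S₁ S₂ S₃

end Literature.Probability.FitznerVanDerHofstad2017

end
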